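import Literature.NumberTheory.Sieve.QuadraticRootsAllModuliPowerSavingProofs
import Literature.NumberTheory.LFunctions.KloostermanIncompleteInterval
import Literature.NumberTheory.LFunctions.MoebiusWalshSparseDyadic
import Literature.NumberTheory.Sieve.MoebiusShiftedPrimesMinorArcForm
import Literature.NumberTheory.Sieve.BombieriAsymptoticSieveSigma0Comb
import HarnessLib

/-!
# Twisted Hooley sums: roots of `Q²X² − D` to the moduli of a residue class, with polynomial losses in `Q`

Topic `Literature/NumberTheory/Sieve`.  For an integer `D` which is not a square, `Q ≥ 1`, a class
`u (mod Q)` and `h ≠ 0`, this file PROVES (everything below is kernel-checked; no named fact is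
introduced)

  `‖∑_{m ≤ M, m ≡ u (mod Q), (m, Q) = 1} S_{Q²X²−D}(h, m)‖ ≤ K(D) · Q^5 · |h|^5 · M^{7/8}`
  (`norm_sum_twistedDilates_le`),

where `S_f(h, m) = ∑_{ν mod m, f(ν) ≡ 0} e(hν/m)` (`polyRootWeylSum`).  For `Q = 1` this is C. Hooley's
theorem on the roots of `ν² ≡ D (mod m)` to all moduli (Acta Math. 110 (1963), Theorem 1; PROVED in
the tree as `hooley1963_quadraticRoots_allModuli_logSqSaving_holds`, with `M^{3/4} log² M`).  The point
here is the UNIFORMITY in the class modulus `Q` (polynomial losses), which is what the balanced-semiprime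
layer of a quadratic Bateman–Horn coordinate consumes (route `RoughValueTransport`, crux
`BalancedSemiprimeLayer`, line `smooth-modulus-twisted-hooley`: the progression modulus of the spectator
coordinates becomes a dilation of the quadratic).

## The method ("route B": the discriminant stays `4D`)

Running Hooley's argument for the forms of discriminant `4Q²D` is NOT uniform in `Q` when `D > 0`: the
automorph group of those forms is generated by the unit of the order of conductor `Q`, whose regulator can
be as large as `≍ Q`, and the Pell-sector fundamental domain then has slices of length `≍ η_Q √N`.  Instead:

* **dilation + reciprocity** (`polyRootWeylSum_dilate`, `e_dilatedRoot_eq`): for `(m, Q) = 1` the roots of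
  `Q²X² − D` are `μ = Q̄ν`, `ν² ≡ D`, and for ANY representative `ν'` of `ν`,
  `e(hμ/m) = e(hν'/(Qm)) · e(−h m̄ ν'/Q)` (`m m̄ ≡ 1 (mod Q)`); so the sum is a sum over the roots of
  `X² − D` — discriminant `4D`, FIXED — of a `Q`-dependent phase (`Froot`, `sum_filter_dilate_eq_sum_levelForms`,
  through the general-summand form `sum_roots_sq_sub_eq_sum_levelForms` of DFI (13)–(14));
* **classes and vectors** (tree, unchanged): `sum_levelFormsUpTo_eq_sum_classReps`, and in each class the
  `T`-reduced forms are `vecForm P (p, r)` for the primitive vectors of a fundamental domain, counted slice by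
  slice (`Hooley1963.SliceData`, `sum_vecSet_eq`, `sum_vecSet_eq_sum_slices`; definite: half-plane,
  indefinite: Pell sector of the FIXED discriminant);
* **the twisted fraction formula** (`e_vecForm_twisted_eq`, exact; `dvd_Yfun`, `dvd_Yfun_sub`,
  `hooleyPhase_mul_e_eq`): with `n = P(p, r)`, `r = r₁ r₂` (`r₂` the `Q`-part of `r`), the phase is
  `e(h u p̄/r₁) · Ψ_r(p) · e(−h(2Ap + Br)/(2Qrn))` with `Ψ_r` periodic modulo `Q r₂` and `|Ψ_r| ≤ 1`
  — the `r₁`-part is a Kloosterman phase, because the two terms linear in `p` with denominator `r₁`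
  cancel;
* **slices** (`norm_slice_le`): grouping `p` by classes modulo `Q r₂`, each class is an incomplete
  Kloosterman sum over a progression — the tree's PROVED `KI_sum_progression_le` (Weil's bound) — and the
  small twist is removed crudely (`‖e(x) − 1‖ ≤ 2π|x|`, `|2Ap + Br| r ≤ κ P(p,r)` on the slices:
  `definite_arg_le`, `indefinite_arg_le`);
* **summation over the slices** (`exists_sum_sliceBound_le`): through `r = r₁ r₂` and Rankin's bound
  `#{s ≤ R : s ∣ Q^∞} ≤ R^{1/8} Q^4` (`card_qSmooth_le`), giving `Q^5 |h| N^{13/16}(1 + log N)²` per class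
  (`exists_norm_class_sum_le`, `exists_classFibre_bound`), hence `K(D) Q^5 |h|^5 M^{7/8}` in total.

## References

* C. Hooley, *On the number of divisors of quadratic polynomials*, Acta Math. 110 (1963), 97–114, §6 and
  Theorem 1. [cite: Hooley1963, §6]
* C. Hooley, *On the greatest prime factor of a quadratic polynomial*, Acta Math. 117 (1967), §6 (27)–(35)
  (the vector parametrisation and the fraction formula). [cite: Hooley1967, §6 (27)–(30)]
* W. Duke, J. B. Friedlander, H. Iwaniec, Ann. of Math. 141 (1995), §2 (13)–(14) (roots as level forms).
  [cite: DukeFriedlanderIwaniec1995, (13)–(14) p. 428]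
* H. Iwaniec, Invent. Math. 47 (1978), Lemma 6 (incomplete Kloosterman sums). [cite: IwaniecInventiones1978, Lemma 6]
-/

noncomputable section

namespace Literature.NumberTheory.Sieve

namespace TwistedHooley


open Polynomial Finset
open Literature.NumberTheory.Sieve
open Literature.NumberTheory.QuadraticFields.Quadratic (BinQF)
open Literature.NumberTheory.Sieve.Iwaniec1978 (hooleyPhase)
open RootForms
open Literature.NumberTheory.LFunctions (KI_sum_progression_le)
open scoped BigOperators MatrixGroups

/-- The roots of the dilate: for a unit `q` of `ZMod m`, `x` is a root of `q²X² − D` iff `q·x` is a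
root of `X² − D`. [folklore] -/
theorem mem_polyRootsMod_dilate_iff {m : ℕ} [NeZero m] (Q : ℕ) (D : ℤ) (x : ZMod m) :
    x ∈ polyRootsMod (C ((Q : ℤ) ^ 2) * X ^ 2 - C D) m ↔
      ((Q : ZMod m) * x) ∈ polyRootsMod (X ^ 2 - C D) m := by
  simp only [mem_polyRootsMod, Polynomial.map_sub, Polynomial.map_mul, Polynomial.map_pow,
    Polynomial.map_X, eval_sub, eval_mul, eval_pow, eval_X, eq_intCast,
    Int.cast_natCast, Polynomial.map_natCast, Polynomial.map_intCast, eval_natCast,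
    eval_intCast, map_pow]
  constructor <;> intro h <;> linear_combination h

/-- **L1 (dilation).** For `(m, Q) = 1` and `a ∈ ZMod m`:
`W_{Q²X²−D}(a; m) = W_{X²−D}(a·Q⁻¹; m)` — substitute `ν = Q x`. [folklore] -/
theorem polyRootWeylSumZMod_dilate {m : ℕ} [NeZero m] {Q : ℕ} (hQ : m.Coprime Q) (D : ℤ)
    (a : ZMod m) :
    polyRootWeylSumZMod (C ((Q : ℤ) ^ 2) * X ^ 2 - C D) m a =
      polyRootWeylSumZMod (X ^ 2 - C D) m (a * (Q : ZMod m)⁻¹) := by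
  have hu : IsUnit (Q : ZMod m) := (ZMod.isUnit_iff_coprime Q m).2 hQ.symm
  have hinv : (Q : ZMod m) * (Q : ZMod m)⁻¹ = 1 := ZMod.mul_inv_of_unit _ hu
  rw [polyRootWeylSumZMod_def, polyRootWeylSumZMod_def]
  refine Finset.sum_nbij' (fun x => (Q : ZMod m) * x) (fun y => (Q : ZMod m)⁻¹ * y) ?_ ?_ ?_ ?_ ?_
  · intro x hx
    exact (mem_polyRootsMod_dilate_iff Q D x).1 hx
  · intro y hy
    rw [mem_polyRootsMod_dilate_iff, ← mul_assoc, hinv, one_mul]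
    exact hy
  · intro x _
    rw [← mul_assoc, mul_comm _ (Q : ZMod m), hinv, one_mul]
  · intro y _
    rw [← mul_assoc, hinv, one_mul]
  · intro x _
    congr 1
    rw [mul_assoc, ← mul_assoc ((Q : ZMod m)⁻¹), mul_comm ((Q : ZMod m)⁻¹), hinv, one_mul]

/-- **L1 for `S_f(h, m)`.** For `(m, Q) = 1` and an integer `e` with `Q e ≡ 1 (mod m)`:
`S_{Q²X²−D}(h, m) = S_{X²−D}(h e, m)`. [folklore] -/
theorem polyRootWeylSum_dilate {m Q : ℕ} (hQ : m.Coprime Q) (D : ℤ) {e : ℤ}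
    (he : (Q : ℤ) * e ≡ 1 [ZMOD m]) (h : ℤ) :
    polyRootWeylSum (C ((Q : ℤ) ^ 2) * X ^ 2 - C D) m h = polyRootWeylSum (X ^ 2 - C D) m (h * e) := by
  rcases Nat.eq_zero_or_pos m with rfl | hm
  · simp
  haveI : NeZero m := ⟨hm.ne'⟩
  rw [polyRootWeylSum_eq_zmod, polyRootWeylSum_eq_zmod, polyRootWeylSumZMod_dilate hQ]
  congr 1
  have hu : IsUnit (Q : ZMod m) := (ZMod.isUnit_iff_coprime Q m).2 hQ.symm
  have h1 : (Q : ZMod m) * (e : ZMod m) = 1 := by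
    have := (ZMod.intCast_eq_intCast_iff _ _ _).2 he
    push_cast at this
    exact this
  have hinv : (Q : ZMod m)⁻¹ = (e : ZMod m) := by
    rw [← mul_one (Q : ZMod m)⁻¹, ← h1, ← mul_assoc, ZMod.inv_mul_of_unit _ hu, one_mul]
  rw [hinv]
  push_cast
  ring

/-! ### L2 — reciprocity for the dilated root (blueprint (1.1)) -/

/-- `e(t) := exp(2πi t)` for a complex (in practice rational) argument. [folklore] -/
def e (t : ℂ) : ℂ := Complex.exp (2 * Real.pi * Complex.I * t)

/-- `e(s + t) = e(s) e(t)`. [folklore] -/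
theorem e_add (s t : ℂ) : e (s + t) = e s * e t := by
  unfold e; rw [mul_add, Complex.exp_add]

/-- `e(k) = 1` for an integer `k`. [folklore] -/
theorem e_intCast (k : ℤ) : e (k : ℂ) = 1 := by
  unfold e
  rw [show 2 * Real.pi * Complex.I * (k : ℂ) = (k : ℂ) * (2 * Real.pi * Complex.I) by ring]
  exact Complex.exp_int_mul_two_pi_mul_I k

/-- `e(t + k) = e(t)` for an integer `k`. [folklore] -/
theorem e_add_intCast (t : ℂ) (k : ℤ) : e (t + k) = e t := by
  rw [e_add, e_intCast, mul_one]

/-- `‖e(t)‖ = 1` for real `t`. [folklore] -/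
theorem norm_e_ofReal (t : ℝ) : ‖e (t : ℂ)‖ = 1 := by
  unfold e
  rw [show 2 * Real.pi * Complex.I * (t : ℂ) = ((2 * Real.pi * t : ℝ) : ℂ) * Complex.I by
    push_cast; ring]
  exact Complex.norm_exp_ofReal_mul_I _

/-- **L2 (reciprocity for the dilated root).** Let `m, Q ≥ 1`, and let the integers `μ, ν', j, m̄`
satisfy `Q μ = ν' + j m` (so `μ ≡ Q̄ ν' (mod m)`) and `m m̄ ≡ 1 (mod Q)`.  Then
`e(h μ/m) = e(h ν'/(Q m)) · e(−h m̄ ν'/Q)`: indeed `h μ/m = h ν'/(Qm) + h j/Q` and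
`j ≡ −m̄ ν' (mod Q)`. [folklore] -/
theorem e_dilatedRoot_eq {m Q : ℕ} (hm : 0 < m) (hQ : 0 < Q) {μ ν' j mbar : ℤ}
    (hμ : (Q : ℤ) * μ = ν' + j * m) (hmbar : (m : ℤ) * mbar ≡ 1 [ZMOD Q]) (h : ℤ) :
    e ((h : ℂ) * μ / m) = e ((h : ℂ) * ν' / ((Q : ℂ) * m)) * e (-((h : ℂ) * mbar * ν') / Q) := by
  -- `j + m̄ ν' = Q t` for an integer `t`
  obtain ⟨c, hc⟩ := Int.modEq_iff_dvd.1 hmbar.symm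
  -- hc : (m * mbar - 1) = Q * c  (up to sign conventions of modEq_iff_dvd)
  have hjQ : (Q : ℤ) ∣ j + mbar * ν' := by
    -- from `Q μ = ν' + j m`: `mbar ν' = mbar Q μ - j m mbar`, so
    -- `j + mbar ν' = j (1 - m mbar) + Q mbar μ = -j Q c + Q mbar μ`.
    refine ⟨mbar * μ - j * c, ?_⟩
    have e1 : mbar * ν' = mbar * ((Q : ℤ) * μ) - j * m * mbar := by rw [hμ]; ring
    have e2 : (m : ℤ) * mbar - 1 = Q * c := by linear_combination hc
    linear_combination e1 - j * e2
  obtain ⟨t, ht⟩ := hjQ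
  have hmC : (m : ℂ) ≠ 0 := by exact_mod_cast hm.ne'
  have hQC : (Q : ℂ) ≠ 0 := by exact_mod_cast hQ.ne'
  have hμC : (Q : ℂ) * (μ : ℂ) = (ν' : ℂ) + (j : ℂ) * (m : ℂ) := by exact_mod_cast hμ
  have htC : (j : ℂ) + (mbar : ℂ) * (ν' : ℂ) = (Q : ℂ) * (t : ℂ) := by exact_mod_cast ht
  have num : (h : ℂ) * μ * Q = h * ν' - h * mbar * ν' * m + h * t * ((Q : ℂ) * m) := by
    linear_combination (h : ℂ) * hμC + (h : ℂ) * (m : ℂ) * htC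
  have key : (h : ℂ) * μ / m =
      (h : ℂ) * ν' / ((Q : ℂ) * m) + -((h : ℂ) * mbar * ν') / Q + ((h * t : ℤ) : ℂ) := by
    have e1 : (h : ℂ) * μ / m = (h : ℂ) * μ * Q / ((Q : ℂ) * m) := by
      rw [mul_comm (Q : ℂ) (m : ℂ), ← mul_div_mul_right _ (m : ℂ) hQC]
    rw [e1, num, add_div, sub_div, sub_eq_add_neg, neg_div]
    congr 2
    · rw [mul_div_mul_right _ _ hmC]
    · push_cast
      rw [mul_div_assoc, div_self (mul_ne_zero hQC hmC), mul_one]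
  rw [key, e_add_intCast, e_add]

/-! ### L3a — the twisted fraction formula (blueprint (3.1)), exact form -/

/-- **L3a (twisted fraction formula, exact).**  Let `P = [A, B, C]` with `B` even, `(p, r)` primitive
with `r > 0`, `n = P(p, r) > 0`, `R = vecForm P (p, r)` (so `A_R = n`, `B_R` even), `Q ≥ 1` and
`n·m̄ ≡ 1 (mod Q)`; put `ℓ = (1 − m̄ n)/Q ∈ ℤ` and `L = 2Ap + Br`.  Then for every integer `h`
`e(h (B_R/2)/(Q n)) · e(−h m̄ (B_R/2)/Q) = e(h ℓ p̄/r) · e(h m̄ L/(2 Q r)) · e(−h L/(2 Q r n))`,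
`p p̄ ≡ 1 (mod r)` (`e(hℓp̄/r)` = `hooleyPhase (hℓ) r p`).  From the tree's integer identity
`r·B_{P·ξ} = 2r'n − L` (`ξ = (p p'; r r')`), `B_R = B_{P·ξ} + 2nk`, `r' ≡ p̄ (mod r)`, and
`h ν/(Qn) − h m̄ ν/Q = h ν ℓ/n` (`ν = B_{P·ξ}/2 = (r'n − L/2)/r`). [folklore] -/
theorem e_vecForm_twisted_eq {P : BinQF} (hB : Even P.b) {p r : ℤ} (hv : Int.gcd p r = 1)
    (hr : 0 < r) (hn : 0 < P.eval p r) {Q : ℕ} (hQ : 0 < Q) {mbar : ℤ}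
    (hmbar : P.eval p r * mbar ≡ 1 [ZMOD Q]) (h : ℤ) :
    e ((h : ℂ) * (((vecForm P (p, r)).b / 2 : ℤ) : ℂ) / ((Q : ℂ) * (P.eval p r : ℂ))) *
        e (-((h : ℂ) * mbar * (((vecForm P (p, r)).b / 2 : ℤ) : ℂ)) / Q) =
      hooleyPhase (h * ((1 - mbar * P.eval p r) / Q)) r.toNat p *
        e ((h : ℂ) * mbar * ((2 * P.a * p + P.b * r : ℤ) : ℂ) / (2 * (Q : ℂ) * r)) *
        e (-((h : ℂ) * ((2 * P.a * p + P.b * r : ℤ) : ℂ)) / (2 * (Q : ℂ) * r * (P.eval p r : ℂ))) := by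
  -- the objects of the tree's proof of `exp_vecForm_b_div_eq`
  set col := colMatrix p r hv with hcol
  set p' : ℤ := col 0 1 with hp'
  set r' : ℤ := col 1 1 with hr'
  have h00 : col 0 0 = p := by rw [hcol, colMatrix_apply_00]
  have h10 : col 1 0 = r := by rw [hcol, colMatrix_apply_10]
  have hdet : p * r' - p' * r = 1 := by
    have hd := col.det_coe
    rw [Matrix.det_fin_two, h00, h10] at hd
    rw [hp', hr']
    linear_combination hd
  set Q₀ := smul P col with hQ₀
  set k := tExp Q₀ with hk
  set n := P.eval p r with hn'
  have hQ₀a : Q₀.a = n := by rw [hQ₀, smul_a, h00, h10]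
  have hR : vecForm P (p, r) = smul Q₀ (ModularGroup.T ^ k) := by
    rw [vecForm_eq P (v := (p, r)) hv]; rfl
  have hRb : (vecForm P (p, r)).b = Q₀.b + 2 * n * k := by rw [hR, smul_T_zpow, hQ₀a]
  have hQ₀b : Q₀.b = 2 * P.a * p * p' + P.b * (p * r' + p' * r) + 2 * P.c * r * r' := by
    rw [hQ₀, smul_b, h00, h10]
  have hid : r * Q₀.b = 2 * r' * n - (2 * P.a * p + P.b * r) := by
    rw [hQ₀b, hn', BinQF.eval]
    linear_combination (-(2 * P.a * p + P.b * r)) * hdet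
  -- `B_{Q₀}` is even
  obtain ⟨B', hB'⟩ := hB
  obtain ⟨ν, hν⟩ : ∃ ν : ℤ, Q₀.b = 2 * ν := by
    refine ⟨P.a * p * p' + B' * (p * r' + p' * r) + P.c * r * r', ?_⟩
    rw [hQ₀b, hB']; ring
  have hRb2 : (vecForm P (p, r)).b / 2 = ν + n * k := by
    have : (vecForm P (p, r)).b = 2 * (ν + n * k) := by rw [hRb, hν]; ring
    rw [this, Int.mul_ediv_cancel_left _ two_ne_zero]
  -- `ℓ` and the relation `1 - mbar n = Q ℓ`
  obtain ⟨ℓ, hℓ⟩ : (Q : ℤ) ∣ 1 - mbar * n := by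
    have := Int.modEq_iff_dvd.1 hmbar
    simpa [mul_comm] using this
  have hℓ' : (1 - mbar * n) / Q = ℓ := by
    rw [hℓ]; exact Int.mul_ediv_cancel_left _ (by exact_mod_cast hQ.ne')
  rw [hRb2, hℓ']
  -- `r' ≡ p̄ (mod r)`
  set Rn := r.toNat with hRn
  have hRr : (Rn : ℤ) = r := Int.toNat_of_nonneg hr.le
  haveI : NeZero Rn := ⟨by omega⟩
  have hinv : ((p : ZMod Rn)⁻¹) = (r' : ZMod Rn) := by
    apply ZMod.inv_eq_of_mul_eq_one
    have h1 : ((p * r' - p' * r : ℤ) : ZMod Rn) = 1 := by rw [hdet]; simp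
    have hr0 : ((r : ℤ) : ZMod Rn) = 0 := by rw [← hRr, Int.cast_natCast, ZMod.natCast_self]
    push_cast at h1
    rw [hr0, mul_zero, sub_zero] at h1
    exact h1
  obtain ⟨t, ht⟩ : ∃ t : ℤ, r' = (((p : ZMod Rn)⁻¹).val : ℤ) + r * t := by
    refine ⟨r' / r, ?_⟩
    rw [hinv, ZMod.val_intCast, hRr, Int.emod_def]; ring
  -- the exact identity between the arguments (blueprint (3.1))
  have hrC : (r : ℂ) ≠ 0 := by exact_mod_cast hr.ne'
  have hnC : (n : ℂ) ≠ 0 := by exact_mod_cast hn.ne'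
  have hQC : (Q : ℂ) ≠ 0 := by exact_mod_cast hQ.ne'
  have hRC : (Rn : ℂ) = (r : ℂ) := by
    have : ((Rn : ℤ) : ℂ) = (r : ℂ) := by rw [hRr]
    exact_mod_cast this
  have hνr : (r : ℂ) * ν = r' * n - (P.a * p + B' * r) := by
    have : r * (2 * ν) = 2 * r' * n - (2 * P.a * p + 2 * B' * r) := by rw [← hν, hid, hB']; ring
    have : r * ν = r' * n - (P.a * p + B' * r) := by linarith
    exact_mod_cast this
  have hℓC : (1 : ℂ) - mbar * n = Q * ℓ := by exact_mod_cast hℓ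
  have htC : (r' : ℂ) = ((((p : ZMod Rn)⁻¹).val : ℕ) : ℂ) + r * t := by
    have : ((r' : ℤ) : ℂ) = (((((p : ZMod Rn)⁻¹).val : ℤ) + r * t : ℤ) : ℂ) := by rw [← ht]
    push_cast at this; exact this
  set pb : ℂ := ((((p : ZMod Rn)⁻¹).val : ℕ) : ℂ) with hpb
  have hL : ((2 * P.a * p + P.b * r : ℤ) : ℂ) = 2 * ((P.a : ℂ) * p + B' * r) := by
    rw [hB']; push_cast; ring
  -- both arguments, multiplied by `Q r n`, are polynomial expressions
  set LHSa : ℂ := (h : ℂ) * ((ν + n * k : ℤ) : ℂ) / ((Q : ℂ) * n) +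
    -((h : ℂ) * mbar * ((ν + n * k : ℤ) : ℂ)) / Q with hLHSa
  set RHSa : ℂ := ((h * ℓ : ℤ) : ℂ) * pb / (Rn : ℂ) +
        (h : ℂ) * mbar * ((2 * P.a * p + P.b * r : ℤ) : ℂ) / (2 * (Q : ℂ) * r) +
        -((h : ℂ) * ((2 * P.a * p + P.b * r : ℤ) : ℂ)) / (2 * (Q : ℂ) * r * n) with hRHSa
  have hQrn : (Q : ℂ) * r * n ≠ 0 := mul_ne_zero (mul_ne_zero hQC hrC) hnC
  have h1 : LHSa * ((Q : ℂ) * r * n) = h * (ν + n * k) * r - h * mbar * (ν + n * k) * r * n := by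
    rw [hLHSa]; push_cast; field_simp; ring
  have h2 : RHSa * ((Q : ℂ) * r * n) =
      h * ℓ * pb * Q * n + h * mbar * (P.a * p + B' * r) * n - h * (P.a * p + B' * r) := by
    rw [hRHSa, hRC, hL]; push_cast; field_simp; ring
  have h3 : h * (ν + n * k) * r - h * mbar * (ν + n * k) * r * n =
      (h * ℓ * pb * Q * n + h * mbar * (P.a * p + B' * r) * n - h * (P.a * p + B' * r)) +
        ((h * ℓ * t + h * k * ℓ : ℤ) : ℂ) * ((Q : ℂ) * r * n) := by
    push_cast
    linear_combination ((h : ℂ) * Q * ℓ) * hνr + ((h : ℂ) * ((ν + n * k) * r + (P.a * p + B' * r))) * hℓC +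
      ((h : ℂ) * ℓ * Q * n) * htC
  have key : LHSa = RHSa + ((h * ℓ * t + h * k * ℓ : ℤ) : ℂ) := by
    have : LHSa * ((Q : ℂ) * r * n) = (RHSa + ((h * ℓ * t + h * k * ℓ : ℤ) : ℂ)) * ((Q : ℂ) * r * n) := by
      rw [h1, add_mul, h2]; exact h3
    exact mul_right_cancel₀ hQrn this
  -- conclude
  have hphase : hooleyPhase (h * ℓ) Rn p = e (((h * ℓ : ℤ) : ℂ) * pb / (Rn : ℂ)) := by
    rw [hooleyPhase, hpb, e, Int.cast_mul]
  have hlhs : e ((h : ℂ) * ((ν + n * k : ℤ) : ℂ) / ((Q : ℂ) * (n : ℂ))) *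
      e (-((h : ℂ) * (mbar : ℂ) * ((ν + n * k : ℤ) : ℂ)) / (Q : ℂ)) = e LHSa := by
    rw [hLHSa, ← e_add]
  rw [hlhs, key, e_add_intCast, hRHSa, e_add, e_add, hphase]

/-! ### L3b — the `r₁`-part is a Kloosterman phase, the rest is `Q r₂`-periodic (blueprint (3.2)) -/

/-- The canonical inverse `m̄ ∈ [0, Q)` of `n` modulo `Q` (junk if `(n, Q) > 1`). [folklore] -/
def mbarOf (Q : ℕ) (n : ℤ) : ℤ := ((((n : ZMod Q))⁻¹).val : ℤ)

/-- The canonical inverse `p̄ ∈ [0, s)` of `p` modulo `s` (junk if `(p, s) > 1`), as in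
`Iwaniec1978.hooleyPhase`. [folklore] -/
def pbarOf (s : ℕ) (p : ℤ) : ℤ := ((((p : ZMod s))⁻¹).val : ℤ)

/-- An integer coprime to `s` is a unit modulo `s`. [folklore] -/
theorem isUnit_intCast_of_gcd_eq_one {s : ℕ} {p : ℤ} (hp : Int.gcd p s = 1) : IsUnit (p : ZMod s) := by
  rw [ZMod.coe_int_isUnit_iff_isCoprime, Int.isCoprime_iff_gcd_eq_one, Int.gcd_comm]
  exact hp

/-- `n · m̄ = 1` in `ZMod Q` for `(n, Q) = 1`. [folklore] -/
theorem mul_mbarOf_eq_one {Q : ℕ} (hQ : 0 < Q) {n : ℤ} (hn : Int.gcd n Q = 1) :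
    (n : ZMod Q) * (mbarOf Q n : ZMod Q) = 1 := by
  haveI : NeZero Q := ⟨hQ.ne'⟩
  rw [mbarOf]
  push_cast
  rw [ZMod.natCast_zmod_val]
  exact ZMod.mul_inv_of_unit _ (isUnit_intCast_of_gcd_eq_one hn)

/-- `n · m̄ ≡ 1 (mod Q)` for `(n, Q) = 1`. [folklore] -/
theorem mul_mbarOf_modEq {Q : ℕ} (hQ : 0 < Q) {n : ℤ} (hn : Int.gcd n Q = 1) :
    n * mbarOf Q n ≡ 1 [ZMOD Q] := by
  rw [← ZMod.intCast_eq_intCast_iff]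
  push_cast
  exact mul_mbarOf_eq_one hQ hn

/-- `p · p̄ = 1` in `ZMod s` for `(p, s) = 1`. [folklore] -/
theorem mul_pbarOf_eq_one {s : ℕ} (hs : 0 < s) {p : ℤ} (hp : Int.gcd p s = 1) :
    (p : ZMod s) * (pbarOf s p : ZMod s) = 1 := by
  haveI : NeZero s := ⟨hs.ne'⟩
  rw [pbarOf]
  push_cast
  rw [ZMod.natCast_zmod_val]
  exact ZMod.mul_inv_of_unit _ (isUnit_intCast_of_gcd_eq_one hp)

/-- `p · p̄ = 1` in `ZMod s₁` for `(p, s) = 1` and `s₁ ∣ s` (the inverse mod `s` reduces to the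
inverse mod `s₁`). [folklore] -/
theorem mul_pbarOf_eq_one_of_dvd {s s₁ : ℕ} (hs : 0 < s) (hd : s₁ ∣ s) {p : ℤ} (hp : Int.gcd p s = 1) :
    (p : ZMod s₁) * (pbarOf s p : ZMod s₁) = 1 := by
  have h := mul_pbarOf_eq_one hs hp
  have := congrArg (ZMod.castHom hd (ZMod s₁)) h
  push_cast [map_mul, map_one, map_intCast] at this
  exact this

/-- **The integer `Y(p)`** of blueprint (3.2): with `n = P(p, r)`, `m̄ = mbarOf Q n`, `Qℓ = 1 − m̄ n`,
`Y(p) = h (1 − m̄ n) p̄_r + h m̄ (A p + (B/2) r) − h u (Q r₂) p̄_{r₁}`; the phase of L3a without its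
twist is `e(Y(p)/(Q r)) · e(h u p̄_{r₁}/r₁)`. [folklore] -/
def Yfun (P : BinQF) (r : ℤ) (Q r₁ r₂ : ℕ) (u h p : ℤ) : ℤ :=
  h * (1 - mbarOf Q (P.eval p r) * P.eval p r) * pbarOf r.toNat p +
    h * mbarOf Q (P.eval p r) * (P.a * p + P.b / 2 * r) - h * u * ((Q : ℤ) * r₂) * pbarOf r₁ p

/-- **Claim A: `r₁ ∣ Y(p)`.**  Modulo `r₁` (`r₁ ∣ r`, `(r₁, Q r₂) = 1`, `u Q r₂ ≡ 1`): `r ≡ 0`,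
`n ≡ A p²`, `p̄_r ≡ p̄_{r₁} ≡ p⁻¹`, so `Y ≡ h(1 − m̄ A p²)p⁻¹ + h m̄ A p − h p⁻¹ ≡ 0`. [folklore] -/
theorem dvd_Yfun {P : BinQF} {r : ℤ} {Q r₁ r₂ : ℕ} (hr : 0 < r) (hr₁ : 0 < r₁)
    (hrr : r = (r₁ : ℤ) * r₂) {u : ℤ} (hu : u * ((Q : ℤ) * r₂) ≡ 1 [ZMOD r₁])
    {p : ℤ} (hp : Int.gcd p r = 1) (h : ℤ) :
    (r₁ : ℤ) ∣ Yfun P r Q r₁ r₂ u h p := by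
  haveI : NeZero r₁ := ⟨hr₁.ne'⟩
  have hrn : 0 < r.toNat := by omega
  have hrn' : (r.toNat : ℤ) = r := Int.toNat_of_nonneg hr.le
  have hd : r₁ ∣ r.toNat := ⟨r₂, by zify; rw [hrn', hrr]⟩
  rw [← ZMod.intCast_zmod_eq_zero_iff_dvd, Yfun]
  have h1 : (p : ZMod r₁) * (pbarOf r.toNat p : ZMod r₁) = 1 :=
    mul_pbarOf_eq_one_of_dvd hrn hd (by rw [hrn']; exact hp)
  have hp₁ : Int.gcd p r₁ = 1 := by
    have : Int.gcd p r₁ ∣ Int.gcd p r := by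
      rw [hrr]; exact Int.gcd_dvd_gcd_mul_right_right _ _ _
    rw [hp] at this
    exact Nat.dvd_one.1 this
  have h2 : (p : ZMod r₁) * (pbarOf r₁ p : ZMod r₁) = 1 := mul_pbarOf_eq_one hr₁ hp₁
  have h12 : (pbarOf r.toNat p : ZMod r₁) = (pbarOf r₁ p : ZMod r₁) := by
    calc (pbarOf r.toNat p : ZMod r₁) = (pbarOf r₁ p : ZMod r₁) * ((p : ZMod r₁) * (pbarOf r.toNat p : ZMod r₁)) := by
          rw [← mul_assoc, mul_comm (pbarOf r₁ p : ZMod r₁), h2, one_mul]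
      _ = (pbarOf r₁ p : ZMod r₁) := by rw [h1, mul_one]
  have hr0 : (r : ZMod r₁) = 0 := by
    rw [hrr]; push_cast; rw [ZMod.natCast_self]; ring
  have hu1 : (u : ZMod r₁) * ((Q : ZMod r₁) * r₂) = 1 := by
    have := (ZMod.intCast_eq_intCast_iff _ _ _).2 hu
    push_cast at this
    exact this
  have hn : (P.eval p r : ZMod r₁) = P.a * p ^ 2 := by
    rw [BinQF.eval]; push_cast; rw [hr0]; ring
  push_cast
  rw [hn, h12, hr0]
  linear_combination (-((h : ZMod r₁) * (mbarOf Q (P.eval p r) : ZMod r₁) * P.a * p)) * h2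
    + (-((h : ZMod r₁) * (pbarOf r₁ p : ZMod r₁))) * hu1

/-- `P(p, r) − P(p', r) = (p − p')(A(p + p') + B r)`. [folklore] -/
theorem eval_sub_eval (P : BinQF) (p p' r : ℤ) :
    P.eval p r - P.eval p' r = (p - p') * (P.a * (p + p') + P.b * r) := by
  simp only [BinQF.eval]; ring

/-- `mbarOf Q n` only depends on `n mod Q`. [folklore] -/
theorem mbarOf_eq_of_modEq {Q : ℕ} {n n' : ℤ} (h : n ≡ n' [ZMOD Q]) : mbarOf Q n = mbarOf Q n' := by
  rw [mbarOf, mbarOf, (ZMod.intCast_eq_intCast_iff _ _ _).2 h]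

/-- The canonical inverses of congruent units agree: if `p ≡ p' (mod s₁)`, `s₁ ∣ s`, `s₁ ∣ s'`,
`(p, s) = (p', s') = 1` then `p̄_s ≡ p̄'_{s'} (mod s₁)`. [folklore] -/
theorem pbarOf_intCast_eq {s s' s₁ : ℕ} (hs : 0 < s) (hs' : 0 < s') (hd : s₁ ∣ s) (hd' : s₁ ∣ s')
    {p p' : ℤ} (hp : Int.gcd p s = 1) (hp' : Int.gcd p' s' = 1) (hpp : p ≡ p' [ZMOD s₁]) :
    (pbarOf s p : ZMod s₁) = (pbarOf s' p' : ZMod s₁) := by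
  have h1 := mul_pbarOf_eq_one_of_dvd hs hd hp
  have h2 := mul_pbarOf_eq_one_of_dvd hs' hd' hp'
  rw [(ZMod.intCast_eq_intCast_iff _ _ _).2 hpp] at h1
  calc (pbarOf s p : ZMod s₁) = (pbarOf s p : ZMod s₁) * ((p' : ZMod s₁) * (pbarOf s' p' : ZMod s₁)) := by
        rw [h2, mul_one]
    _ = (pbarOf s' p' : ZMod s₁) := by rw [← mul_assoc, mul_comm (pbarOf s p : ZMod s₁), h1, one_mul]

/-- **Claim B: `Y(p) mod Q r₂` only depends on `p mod Q r₂`** (for `p, p'` coprime to `r`,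
`(P(p, r), Q) = 1`): `m̄` and `A p + (B/2) r mod Q r₂` agree, `Qℓ = 1 − m̄ n` with `ℓ ≡ ℓ' (mod r₂)`,
`p̄_r ≡ p̄'_r (mod r₂)`, so `hQ(ℓ p̄ − ℓ' p̄') ≡ 0 (mod Q r₂)`. [folklore] -/
theorem dvd_Yfun_sub {P : BinQF} {r : ℤ} {Q r₁ r₂ : ℕ} (hr : 0 < r) (hQ : 0 < Q) (_hr₁ : 0 < r₁)
    (hrr : r = (r₁ : ℤ) * r₂) (u : ℤ) {p p' : ℤ} (hp : Int.gcd p r = 1) (hp' : Int.gcd p' r = 1)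
    (hpp : p ≡ p' [ZMOD (Q : ℤ) * r₂]) (hn : Int.gcd (P.eval p r) Q = 1) (h : ℤ) :
    (Q : ℤ) * r₂ ∣ Yfun P r Q r₁ r₂ u h p - Yfun P r Q r₁ r₂ u h p' := by
  have hr₂ : 0 < r₂ := by
    rcases Nat.eq_zero_or_pos r₂ with h0 | h0
    · rw [h0] at hrr; simp at hrr; omega
    · exact h0
  have hrn : 0 < r.toNat := by omega
  have hrn' : (r.toNat : ℤ) = r := Int.toNat_of_nonneg hr.le
  have hd₂ : r₂ ∣ r.toNat := ⟨r₁, by zify; rw [hrn', hrr]; ring⟩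
  set n := P.eval p r with hn_def
  set n' := P.eval p' r with hn'_def
  -- `n ≡ n' (mod Q r₂)`
  have hQr₂ : (Q : ℤ) * r₂ ∣ p - p' := (Int.modEq_iff_dvd.1 hpp.symm)
  have hnn : (Q : ℤ) * r₂ ∣ n - n' := by
    rw [hn_def, hn'_def, eval_sub_eval]; exact hQr₂.mul_right _
  have hnnQ : n ≡ n' [ZMOD Q] := by
    have h1 : (Q : ℤ) ∣ n - n' := (dvd_mul_right _ _).trans hnn
    have h2 : (Q : ℤ) ∣ n' - n := by simpa using h1.neg_right
    exact (Int.modEq_iff_dvd.2 h2)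
  have hmbar : mbarOf Q n' = mbarOf Q n := (mbarOf_eq_of_modEq hnnQ).symm
  set mbar := mbarOf Q n with hmbar_def
  -- `Q ∣ 1 − m̄ n`, `Q ∣ 1 − m̄ n'`
  have hQn : (Q : ℤ) ∣ 1 - mbar * n := by
    have := (mul_mbarOf_modEq hQ hn)
    have := Int.modEq_iff_dvd.1 this
    simpa [mul_comm] using this
  have hn'Q : Int.gcd n' Q = 1 := by
    have e : (n' : ZMod Q) = (n : ZMod Q) := ((ZMod.intCast_eq_intCast_iff _ _ _).2 hnnQ).symm
    have hu : IsUnit (n' : ZMod Q) := by rw [e]; exact isUnit_intCast_of_gcd_eq_one hn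
    rw [ZMod.coe_int_isUnit_iff_isCoprime, Int.isCoprime_iff_gcd_eq_one, Int.gcd_comm] at hu
    exact hu
  have hQn' : (Q : ℤ) ∣ 1 - mbar * n' := by
    have := (mul_mbarOf_modEq hQ hn'Q)
    rw [hmbar] at this
    have := Int.modEq_iff_dvd.1 this
    simpa [mul_comm] using this
  obtain ⟨ℓ, hℓ⟩ := hQn
  obtain ⟨ℓ', hℓ'⟩ := hQn'
  -- `r₂ ∣ ℓ − ℓ'`
  have hℓℓ : (r₂ : ℤ) ∣ ℓ - ℓ' := by
    have h1 : (Q : ℤ) * (ℓ - ℓ') = mbar * (n' - n) := by linear_combination hℓ' - hℓ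
    have h2 : (Q : ℤ) * r₂ ∣ (Q : ℤ) * (ℓ - ℓ') := by
      rw [h1]; simpa using (hnn.neg_right).mul_left mbar
    exact Int.dvd_of_mul_dvd_mul_left (by exact_mod_cast hQ.ne') h2
  -- `p̄_r ≡ p̄'_r (mod r₂)` and `p̄_{r₁}` terms
  have hpprz : p ≡ p' [ZMOD r₂] := hpp.of_mul_left _
  have hpb : (r₂ : ℤ) ∣ pbarOf r.toNat p - pbarOf r.toNat p' := by
    rw [← ZMod.intCast_zmod_eq_zero_iff_dvd]
    push_cast
    rw [pbarOf_intCast_eq hrn hrn hd₂ hd₂ (by rw [hrn']; exact hp) (by rw [hrn']; exact hp') hpprz, sub_self]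
  -- assemble
  have hY : Yfun P r Q r₁ r₂ u h p - Yfun P r Q r₁ r₂ u h p' =
      h * (Q : ℤ) * (ℓ * (pbarOf r.toNat p - pbarOf r.toNat p') + (ℓ - ℓ') * pbarOf r.toNat p') +
        h * mbar * P.a * (p - p') - h * u * ((Q : ℤ) * r₂) * (pbarOf r₁ p - pbarOf r₁ p') := by
    simp only [Yfun, ← hn_def, ← hn'_def, hmbar, ← hmbar_def]
    linear_combination (h * pbarOf r.toNat p) * hℓ - (h * pbarOf r.toNat p') * hℓ'
  rw [hY]
  refine Dvd.dvd.sub (Dvd.dvd.add ?_ ?_) ?_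
  · rw [mul_assoc]
    refine Dvd.dvd.mul_left (mul_dvd_mul_left _ ?_) _
    exact Dvd.dvd.add (hpb.mul_left _) (hℓℓ.mul_right _)
  · exact hQr₂.mul_left _
  · exact (dvd_mul_left ((Q : ℤ) * r₂) (h * u)).mul_right _

/-- **L3c — the phase of L3a splits as `e(Y(p)/(Qr)) · e(h u p̄_{r₁}/r₁)`.**  With `m̄ = mbarOf Q n`,
`Qℓ = 1 − m̄ n`, `B = 2B'`: `e(hℓ p̄_r/r) · e(h m̄ (2Ap + Br)/(2Qr)) = e(Y(p)/(Q r)) · e(h u p̄_{r₁}/r₁)`,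
because `hQℓ p̄_r + h m̄ (Ap + B'r) = Y(p) + h u (Q r₂) p̄_{r₁}` and `Q r₂/(Q r) = 1/r₁`. [folklore] -/
theorem hooleyPhase_mul_e_eq {P : BinQF} (hB : Even P.b) {r : ℤ} {Q r₁ r₂ : ℕ} (hr : 0 < r)
    (hQ : 0 < Q) (hr₁ : 0 < r₁) (hrr : r = (r₁ : ℤ) * r₂) (u : ℤ) {p : ℤ}
    (hn : Int.gcd (P.eval p r) Q = 1) (h : ℤ) :
    hooleyPhase (h * ((1 - mbarOf Q (P.eval p r) * P.eval p r) / Q)) r.toNat p *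
        e ((h : ℂ) * mbarOf Q (P.eval p r) * ((2 * P.a * p + P.b * r : ℤ) : ℂ) / (2 * (Q : ℂ) * r)) =
      e ((Yfun P r Q r₁ r₂ u h p : ℂ) / ((Q : ℂ) * r)) * hooleyPhase (h * u) r₁ p := by
  set n := P.eval p r with hn_def
  set mbar := mbarOf Q n with hmbar_def
  obtain ⟨ℓ, hℓ⟩ : (Q : ℤ) ∣ 1 - mbar * n := by
    have := Int.modEq_iff_dvd.1 (mul_mbarOf_modEq hQ hn)
    simpa [mul_comm] using this
  have hℓ' : (1 - mbar * n) / Q = ℓ := by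
    rw [hℓ]; exact Int.mul_ediv_cancel_left _ (by exact_mod_cast hQ.ne')
  obtain ⟨B', hB'⟩ := hB
  have hB2 : P.b / 2 = B' := by rw [hB']; omega
  have hrn' : (r.toNat : ℤ) = r := Int.toNat_of_nonneg hr.le
  have hrC : (r : ℂ) ≠ 0 := by exact_mod_cast hr.ne'
  have hQC : (Q : ℂ) ≠ 0 := by exact_mod_cast hQ.ne'
  have hr₁C : (r₁ : ℂ) ≠ 0 := by exact_mod_cast hr₁.ne'
  have hrnC : ((r.toNat : ℕ) : ℂ) = (r : ℂ) := by exact_mod_cast hrn'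
  have hrrC : (r : ℂ) = (r₁ : ℂ) * r₂ := by exact_mod_cast hrr
  have hr₂ : 0 < r₂ := by
    rcases Nat.eq_zero_or_pos r₂ with h0 | h0
    · rw [h0] at hrr; simp at hrr; omega
    · exact h0
  have hr₂C : (r₂ : ℂ) ≠ 0 := by exact_mod_cast hr₂.ne'
  -- unfold both Hooley phases as `e(·)`
  have h1 : hooleyPhase (h * ((1 - mbar * n) / Q)) r.toNat p =
      e (((h * ℓ : ℤ) : ℂ) * (pbarOf r.toNat p : ℂ) / (r : ℂ)) := by
    rw [hℓ', hooleyPhase, e, pbarOf, hrnC]; push_cast; ring_nf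
  have h2 : hooleyPhase (h * u) r₁ p = e (((h * u : ℤ) : ℂ) * (pbarOf r₁ p : ℂ) / (r₁ : ℂ)) := by
    rw [hooleyPhase, e, pbarOf]; push_cast; ring_nf
  rw [h1, h2, ← e_add, ← e_add]
  congr 1
  rw [Yfun, ← hn_def, ← hmbar_def, hB2, hℓ]
  push_cast
  rw [hrrC]
  field_simp
  rw [hB']
  push_cast
  ring

/-! ### L6 — roots of `X² − D` to all moduli as `T`-reduced forms, for a general summand -/

/-- **General-summand form of DFI (13), first equality**, for `f = aX² + bX + c`, `a > 0`, `n ≥ 1`: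
`∑_{ν mod n, f(ν) ≡ 0} F(ν) = ∑_{B ∈ residues a b c n} F(((B − b)/(2a)) mod n)` (the bijection
`ν ↦ B = 2aν + b (mod 2an)` of `polyRootWeylSum_quad`, with an arbitrary summand). [folklore] -/
theorem sum_roots_eq_sum_residues {a : ℤ} (ha : 0 < a) (b c : ℤ) {n : ℕ} (hn : 0 < n)
    (F : ℕ → ℂ) :
    ∑ ν ∈ (Finset.range n).filter
        (fun ν : ℕ => (n : ℤ) ∣ (C a * X ^ 2 + C b * X + C c : ℤ[X]).eval (ν : ℤ)), F ν =
      ∑ B ∈ residues a b c n, F (((B - b) / (2 * a)) % n).toNat := by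
  have hm : (0 : ℤ) < 2 * a * n := by positivity
  have h2a : (2 * a : ℤ) ≠ 0 := by positivity
  have hn0 : (n : ℤ) ≠ 0 := by exact_mod_cast hn.ne'
  have hleft : ∀ ν ∈ (Finset.range n).filter
      (fun ν : ℕ => (n : ℤ) ∣ (C a * X ^ 2 + C b * X + C c : ℤ[X]).eval (ν : ℤ)),
      ((((2 * a * ν + b) % (2 * a * n) - b) / (2 * a)) % n).toNat = ν := by
    intro ν hν
    rw [mem_filter_roots] at hν
    set y : ℤ := 2 * a * ν + b with hy
    set t : ℤ := y / (2 * a * n) with ht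
    have hdef : y % (2 * a * n) = y - 2 * a * n * t := Int.emod_def y _
    have h1 : (y % (2 * a * n) - b) / (2 * a) = ν - n * t := by
      rw [hdef, hy]
      have : 2 * a * (ν : ℤ) + b - 2 * a * n * t - b = 2 * a * (ν - n * t) := by ring
      rw [this, Int.mul_ediv_cancel_left _ h2a]
    have h2 : ((ν : ℤ) - n * t) % n = ν := by
      have : (ν : ℤ) - n * t = ν + n * (-t) := by ring
      rw [this, Int.add_mul_emod_self_left]
      exact Int.emod_eq_of_lt (by positivity) (by exact_mod_cast hν.1)
    simp only [h1, h2, Int.toNat_natCast]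
  refine Finset.sum_nbij' (fun ν : ℕ => (2 * a * ν + b) % (2 * a * n))
    (fun B : ℤ => (((B - b) / (2 * a)) % n).toNat) ?_ ?_ hleft ?_ ?_
  · intro ν hν
    rw [mem_filter_roots] at hν
    exact toResidue_mem ha hn hν.2
  · intro B hB
    rw [mem_filter_roots]
    have h0 : (0 : ℤ) ≤ ((B - b) / (2 * a)) % n := Int.emod_nonneg _ hn0
    have hcast : (((((B - b) / (2 * a)) % n).toNat : ℕ) : ℤ) = ((B - b) / (2 * a)) % n :=
      Int.toNat_of_nonneg h0
    constructor
    · have : (((((B - b) / (2 * a)) % n).toNat : ℕ) : ℤ) < n := by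
        rw [hcast]; exact Int.emod_lt_of_pos _ (by exact_mod_cast hn)
      exact_mod_cast this
    · rw [hcast]
      exact ofResidue_dvd ha hB
  · intro B hB
    obtain ⟨⟨hB0, hBm⟩, -, h2⟩ := mem_residues.1 hB
    set ν₀ : ℤ := (B - b) / (2 * a) with hν₀
    have hB' : 2 * a * ν₀ + b = B := by
      rw [hν₀, Int.mul_ediv_cancel' h2]; ring
    have h0 : (0 : ℤ) ≤ ν₀ % n := Int.emod_nonneg _ hn0
    have hcast : (((ν₀ % n).toNat : ℕ) : ℤ) = ν₀ % n := Int.toNat_of_nonneg h0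
    rw [hcast, Int.emod_def ν₀ n]
    have : 2 * a * (ν₀ - n * (ν₀ / n)) + b = B + 2 * a * n * (-(ν₀ / n)) := by
      rw [← hB']; ring
    rw [this, Int.add_mul_emod_self_left]
    exact Int.emod_eq_of_lt hB0 hBm
  · intro ν hν
    rw [hleft ν hν]

/-- **Roots of `X² − D` to all moduli `≤ N` as `T`-reduced forms, general summand.**  For
`F : ℕ → ℤ → ℂ` with `F n (ν + n t) = F n ν`,
`∑_{n ≤ N} ∑_{ν mod n, ν² ≡ D} F(n, ν) = ∑_{Q ∈ levelFormsUpTo 1 0 (−D) 1 N} F(A_Q, B_Q/2)`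
(`A_Q = n`, `B_Q = 2ν` up to `T`-translation).  The tree's `sum_polyRootWeylSum_sq_sub_eq` is the
case `F(n, ν) = e(hν/n)`. [cite: DukeFriedlanderIwaniec1995, (13)–(14) p. 428] -/
theorem sum_roots_sq_sub_eq_sum_levelForms (D : ℤ) (N : ℕ) (F : ℕ → ℤ → ℂ)
    (hF : ∀ (n : ℕ) (ν t : ℤ), F n (ν + n * t) = F n ν) :
    ∑ n ∈ Finset.Icc 1 N, ∑ ν ∈ (Finset.range n).filter (fun ν : ℕ => (n : ℤ) ∣ (ν : ℤ) ^ 2 - D),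
        F n ν =
      ∑ Q ∈ levelFormsUpTo 1 0 (-D) 1 N, F (index 1 Q) (Q.b / 2) := by
  rw [levelFormsUpTo, Finset.sum_biUnion]
  · have hfilter : (Finset.Icc 1 N).filter (fun n => 1 ∣ n) = Finset.Icc 1 N :=
      Finset.filter_true_of_mem fun n _ => one_dvd n
    rw [hfilter]
    refine Finset.sum_congr rfl fun n hn => ?_
    simp only [Finset.mem_Icc] at hn
    have hn0 : 0 < n := by omega
    rw [Finset.sum_image fun B _ B' _ e => rootForm_injective 1 0 (-D) n e]
    have hpoly : ∀ ν : ℕ, ((n : ℤ) ∣ (ν : ℤ) ^ 2 - D) ↔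
        ((n : ℤ) ∣ (C (1 : ℤ) * X ^ 2 + C 0 * X + C (-D) : ℤ[X]).eval (ν : ℤ)) := by
      intro ν
      simp only [eval_add, eval_mul, eval_C, eval_pow, eval_X, one_mul, zero_mul, add_zero]
      rw [sub_eq_add_neg]
    rw [Finset.filter_congr (fun ν _ => hpoly ν), sum_roots_eq_sum_residues one_pos 0 (-D) hn0]
    refine Finset.sum_congr rfl fun B hB => ?_
    simp only [index_rootForm one_pos, rootForm_b, sub_zero, mul_one]
    -- `F n ((B/2) mod n) = F n (B/2)`
    have h0 : (0 : ℤ) ≤ (B / 2) % n := Int.emod_nonneg _ (by exact_mod_cast hn0.ne')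
    rw [show ((((B / 2) % (n : ℤ)).toNat : ℕ) : ℤ) = (B / 2) % n from Int.toNat_of_nonneg h0,
      Int.emod_def, show B / 2 - (n : ℤ) * (B / 2 / n) = B / 2 + n * (-(B / 2 / n)) by ring, hF]
  · intro n hn n' hn' hne
    simp only [Finset.coe_filter, Set.mem_setOf_eq] at hn hn'
    rw [Function.onFun, Finset.disjoint_left]
    intro Q hQ hQ'
    simp only [Finset.mem_image] at hQ hQ'
    obtain ⟨B, -, rfl⟩ := hQ
    obtain ⟨B', -, e⟩ := hQ'
    have := congrArg BinQF.a e
    simp only [rootForm_a, one_mul] at this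
    exact hne (by exact_mod_cast this.symm)

/-! ### The `Q`-part / `Q`-free part of a slice index `r` -/

/-- The `Q`-part of `r`: `r₂ = (r, Q^r) = ∏_{p ∣ Q} p^{v_p(r)}` (for `r ≥ 1`). [folklore] -/
def qPart (Q r : ℕ) : ℕ := Nat.gcd r (Q ^ r)

/-- The `Q`-free part `r₁ = r / r₂`. [folklore] -/
def qFree (Q r : ℕ) : ℕ := r / qPart Q r

/-- `r₂ ∣ r`. [folklore] -/
theorem qPart_dvd (Q r : ℕ) : qPart Q r ∣ r := Nat.gcd_dvd_left _ _

/-- `r = r₁ · r₂`. [folklore] -/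
theorem qFree_mul_qPart (Q r : ℕ) : qFree Q r * qPart Q r = r :=
  Nat.div_mul_cancel (qPart_dvd Q r)

/-- `r₂ ≥ 1` for `r ≥ 1`. [folklore] -/
theorem qPart_pos {Q r : ℕ} (hr : 0 < r) : 0 < qPart Q r :=
  Nat.pos_of_ne_zero (Nat.gcd_ne_zero_left hr.ne')

/-- `r₁ ≥ 1` for `r ≥ 1`. [folklore] -/
theorem qFree_pos {Q r : ℕ} (hr : 0 < r) : 0 < qFree Q r := by
  have h := qFree_mul_qPart Q r
  rcases Nat.eq_zero_or_pos (qFree Q r) with h0 | h0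
  · rw [h0, zero_mul] at h; omega
  · exact h0

/-- **`(r₁, Q) = 1`**: a prime `p ∣ Q` dividing `r₁ = r/r₂` would give `p^{v_p(r)+1} ∣ r`.
[folklore] -/
theorem coprime_qFree (Q : ℕ) {r : ℕ} (hr : 0 < r) : Nat.Coprime (qFree Q r) Q := by
  rw [Nat.coprime_iff_gcd_eq_one]
  by_contra hne
  obtain ⟨p, hp, hpd⟩ := Nat.exists_prime_and_dvd hne
  have hp1 : p ∣ qFree Q r := hpd.trans (Nat.gcd_dvd_left _ _)
  have hpQ : p ∣ Q := hpd.trans (Nat.gcd_dvd_right _ _)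
  -- `p · r₂ ∣ r` and `p · r₂ ∣ Q^r`, contradicting maximality of the gcd
  have h1 : p * qPart Q r ∣ r := by
    have := Nat.mul_dvd_mul_right hp1 (qPart Q r)
    rwa [qFree_mul_qPart] at this
  have h2 : p * qPart Q r ∣ Q ^ r := by
    -- for each prime power `q^k ∣ p·r₂`: `q ∣ Q` and `k ≤ r` (as `q^k ∣ r`), so `q^k ∣ Q^r`
    rw [Nat.dvd_iff_prime_pow_dvd_dvd]
    intro q k hq hqk
    rcases Nat.eq_zero_or_pos k with hk0 | hk0
    · subst hk0; simp
    have hqr : q ^ k ∣ r := hqk.trans h1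
    have hk : k ≤ r := by
      have := Nat.le_of_dvd hr hqr
      calc k ≤ q ^ k := (Nat.lt_pow_self hq.one_lt).le
        _ ≤ r := this
    have hqQ : q ∣ Q := by
      have hq1 : q ∣ p * qPart Q r := (dvd_pow_self q hk0.ne').trans hqk
      rcases (Nat.Prime.dvd_mul hq).1 hq1 with h | h
      · exact ((Nat.prime_dvd_prime_iff_eq hq hp).1 h) ▸ hpQ
      · exact hq.dvd_of_dvd_pow (h.trans (Nat.gcd_dvd_right _ _))
    exact (pow_dvd_pow q hk).trans (pow_dvd_pow_of_dvd hqQ r)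
  have h3 : p * qPart Q r ∣ qPart Q r := Nat.dvd_gcd h1 h2
  have h4 : p * qPart Q r ≤ qPart Q r := Nat.le_of_dvd (qPart_pos hr) h3
  have h5 : 2 * qPart Q r ≤ p * qPart Q r := Nat.mul_le_mul_right _ hp.two_le
  have := qPart_pos (Q := Q) hr
  omega

/-- `(Q · r₂, r₁) = 1`. [folklore] -/
theorem coprime_mul_qPart_qFree (Q : ℕ) {r : ℕ} (hr : 0 < r) :
    Nat.Coprime (Q * qPart Q r) (qFree Q r) := by
  have h1 : Nat.Coprime Q (qFree Q r) := (coprime_qFree Q hr).symm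
  have h2 : Nat.Coprime (qPart Q r) (qFree Q r) := by
    have : qPart Q r ∣ Q ^ r := Nat.gcd_dvd_right _ _
    exact Nat.Coprime.coprime_dvd_left this (Nat.Coprime.pow_left r h1)
  exact Nat.Coprime.mul_left h1 h2

/-! ### L4 — the slice bound -/

/-- The twisted weight of a slice term: `e(h ν_R/(Q n)) · e(−h n̄ ν_R/Q)`, `n = P(p, r)`,
`ν_R = B_R/2`, `R = vecForm P (p, r)`, `n̄ = mbarOf Q n`. [folklore] -/
def twW (P : BinQF) (r : ℤ) (Q : ℕ) (h p : ℤ) : ℂ :=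
  e ((h : ℂ) * (((vecForm P (p, r)).b / 2 : ℤ) : ℂ) / ((Q : ℂ) * (P.eval p r : ℂ))) *
    e (-((h : ℂ) * mbarOf Q (P.eval p r) * (((vecForm P (p, r)).b / 2 : ℤ) : ℂ)) / Q)

/-- The small twist `e(−h(2Ap + Br)/(2 Q r n))`. [folklore] -/
def tw (P : BinQF) (r : ℤ) (Q : ℕ) (h p : ℤ) : ℂ :=
  e (-((h : ℂ) * ((2 * P.a * p + P.b * r : ℤ) : ℂ)) / (2 * (Q : ℂ) * r * (P.eval p r : ℂ)))

/-- The class indicator `1[n ≡ u₀ (mod Q), (n, Q) = 1]`, `n = P(p, r)`. [folklore] -/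
def clsInd (P : BinQF) (r : ℤ) (Q u₀ : ℕ) (p : ℤ) : ℂ :=
  if (P.eval p r ≡ u₀ [ZMOD Q] ∧ Int.gcd (P.eval p r) Q = 1) then 1 else 0

/-- `‖clsInd‖ ≤ 1`. [folklore] -/
theorem norm_clsInd_le (P : BinQF) (r : ℤ) (Q u₀ : ℕ) (p : ℤ) : ‖clsInd P r Q u₀ p‖ ≤ 1 := by
  unfold clsInd; split_ifs <;> simp

/-- The class indicator only depends on `p mod Q`. [folklore] -/
theorem clsInd_eq_of_modEq (P : BinQF) (r : ℤ) (Q u₀ : ℕ) {p p' : ℤ} (hpp : p ≡ p' [ZMOD Q]) :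
    clsInd P r Q u₀ p = clsInd P r Q u₀ p' := by
  have hn : P.eval p r ≡ P.eval p' r [ZMOD Q] := by
    have h1 : (Q : ℤ) ∣ P.eval p r - P.eval p' r := by
      rw [eval_sub_eval]; exact (Int.modEq_iff_dvd.1 hpp.symm).mul_right _
    have h2 : (Q : ℤ) ∣ P.eval p' r - P.eval p r := by simpa using h1.neg_right
    exact Int.modEq_iff_dvd.2 h2
  have hg : Int.gcd (P.eval p r) Q = 1 ↔ Int.gcd (P.eval p' r) Q = 1 := by
    constructor <;> intro hc
    · have e : (P.eval p' r : ZMod Q) = (P.eval p r : ZMod Q) :=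
        ((ZMod.intCast_eq_intCast_iff _ _ _).2 hn).symm
      have hu : IsUnit (P.eval p' r : ZMod Q) := by rw [e]; exact isUnit_intCast_of_gcd_eq_one hc
      rwa [ZMod.coe_int_isUnit_iff_isCoprime, Int.isCoprime_iff_gcd_eq_one, Int.gcd_comm] at hu
    · have e : (P.eval p r : ZMod Q) = (P.eval p' r : ZMod Q) :=
        ((ZMod.intCast_eq_intCast_iff _ _ _).2 hn)
      have hu : IsUnit (P.eval p r : ZMod Q) := by rw [e]; exact isUnit_intCast_of_gcd_eq_one hc
      rwa [ZMod.coe_int_isUnit_iff_isCoprime, Int.isCoprime_iff_gcd_eq_one, Int.gcd_comm] at hu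
  unfold clsInd
  have hiff : (P.eval p r ≡ u₀ [ZMOD Q] ∧ Int.gcd (P.eval p r) Q = 1) ↔
      (P.eval p' r ≡ u₀ [ZMOD Q] ∧ Int.gcd (P.eval p' r) Q = 1) :=
    and_congr ⟨fun h1 => hn.symm.trans h1, fun h1 => hn.trans h1⟩ hg
  rw [if_congr hiff rfl rfl]

/-- **L4a — pointwise factorisation of the twisted weight** on a slice:
`twW = e(Y(p)/(Qr)) · e(h u p̄_{r₁}/r₁) · tw` for `(p, r) = 1`, `n = P(p,r) > 0` coprime to `Q`
(`r₁ = qFree`, `r₂ = qPart`, any `u`). [folklore] -/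
theorem twW_eq {P : BinQF} (hB : Even P.b) {r : ℕ} (hr : 0 < r) {Q : ℕ} (hQ : 0 < Q) (u : ℤ)
    {p : ℤ} (hv : Int.gcd p r = 1)
    (hn : 0 < P.eval p r) (hnQ : Int.gcd (P.eval p r) Q = 1) (h : ℤ) :
    twW P r Q h p =
      e ((Yfun P r Q (qFree Q r) (qPart Q r) u h p : ℂ) / ((Q : ℂ) * r)) *
        hooleyPhase (h * u) (qFree Q r) p * tw P r Q h p := by
  have hrz : (0 : ℤ) < r := by exact_mod_cast hr
  have hrr : (r : ℤ) = (qFree Q r : ℤ) * qPart Q r := by exact_mod_cast (qFree_mul_qPart Q r).symm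
  have hL3a := e_vecForm_twisted_eq hB hv hrz hn hQ (mul_mbarOf_modEq hQ hnQ) h
  have hL3c := hooleyPhase_mul_e_eq hB hrz hQ (qFree_pos hr) hrr u hnQ h
  rw [Int.toNat_natCast] at hL3a hL3c
  rw [twW, hL3a, tw]
  push_cast at hL3c ⊢
  rw [← hL3c]

/-- An integer inverse of `Q' = Q r₂` modulo `r₁`, coprime to `r₁`. [folklore] -/
theorem exists_inv_modEq (Q : ℕ) {r : ℕ} (hr : 0 < r) :
    ∃ u : ℤ, u * ((Q : ℤ) * qPart Q r) ≡ 1 [ZMOD qFree Q r] ∧ Int.gcd u (qFree Q r) = 1 := by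
  have hc := coprime_mul_qPart_qFree Q hr
  haveI : NeZero (qFree Q r) := ⟨(qFree_pos hr).ne'⟩
  set Q' : ℕ := Q * qPart Q r with hQ'
  have hunit : IsUnit ((Q' : ℕ) : ZMod (qFree Q r)) := (ZMod.isUnit_iff_coprime _ _).2 hc
  refine ⟨(((Q' : ZMod (qFree Q r)))⁻¹.val : ℤ), ?_, ?_⟩
  · rw [← ZMod.intCast_eq_intCast_iff]
    push_cast
    rw [ZMod.natCast_zmod_val, hQ']
    push_cast
    exact ZMod.inv_mul_of_unit _ (by exact_mod_cast hunit)
  · have hu : IsUnit ((((Q' : ZMod (qFree Q r)))⁻¹.val : ℤ) : ZMod (qFree Q r)) := by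
      push_cast; rw [ZMod.natCast_zmod_val]
      exact IsUnit.of_mul_eq_one _ (ZMod.inv_mul_of_unit _ hunit)
    rwa [ZMod.coe_int_isUnit_iff_isCoprime, Int.isCoprime_iff_gcd_eq_one, Int.gcd_comm] at hu

/-- The grouped weight `Φ = clsInd · e(Y/(Qr))` is constant on the classes `p mod Q r₂` of a slice
(among the `p` prime to `r` with `P(p, r) > 0`). [folklore] -/
theorem clsInd_mul_e_eq_of_modEq {P : BinQF} {r : ℕ} (hr : 0 < r) {Q : ℕ} (hQ : 0 < Q) (u₀ : ℕ)
    {u : ℤ} (hu : u * ((Q : ℤ) * qPart Q r) ≡ 1 [ZMOD qFree Q r]) (h : ℤ) {p p' : ℤ}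
    (hp : Int.gcd p r = 1) (hp' : Int.gcd p' r = 1) (hpp : p ≡ p' [ZMOD (Q : ℤ) * qPart Q r]) :
    clsInd P r Q u₀ p * e ((Yfun P r Q (qFree Q r) (qPart Q r) u h p : ℂ) / ((Q : ℂ) * r)) =
      clsInd P r Q u₀ p' * e ((Yfun P r Q (qFree Q r) (qPart Q r) u h p' : ℂ) / ((Q : ℂ) * r)) := by
  have hppQ : p ≡ p' [ZMOD Q] := hpp.of_mul_right _
  have hcls := clsInd_eq_of_modEq P r Q u₀ hppQ
  by_cases hco : Int.gcd (P.eval p r) Q = 1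
  · -- `Q r ∣ Y(p) − Y(p')`
    have hrz : (0 : ℤ) < r := by exact_mod_cast hr
    have hrr : (r : ℤ) = (qFree Q r : ℤ) * qPart Q r := by exact_mod_cast (qFree_mul_qPart Q r).symm
    have hr₁ := qFree_pos (Q := Q) hr
    have hA := dvd_Yfun (P := P) hrz hr₁ hrr hu hp h
    have hA' := dvd_Yfun (P := P) hrz hr₁ hrr hu hp' h
    have hBd := dvd_Yfun_sub (P := P) hrz hQ hr₁ hrr u hp hp' hpp hco h
    have hcop : IsCoprime ((Q : ℤ) * qPart Q r) (qFree Q r : ℤ) := by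
      rw [Int.isCoprime_iff_gcd_eq_one, show ((Q : ℤ) * qPart Q r) = ((Q * qPart Q r : ℕ) : ℤ) by push_cast; ring,
        Int.gcd_natCast_natCast]
      exact coprime_mul_qPart_qFree Q hr
    have hQr : (Q : ℤ) * r ∣ Yfun P r Q (qFree Q r) (qPart Q r) u h p -
        Yfun P r Q (qFree Q r) (qPart Q r) u h p' := by
      have h1 : ((Q : ℤ) * qPart Q r) * (qFree Q r : ℤ) ∣ _ := hcop.mul_dvd hBd (hA.sub hA')
      have e : (Q : ℤ) * r = ((Q : ℤ) * qPart Q r) * (qFree Q r : ℤ) := by rw [hrr]; ring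
      rw [e]; exact h1
    obtain ⟨k, hk⟩ := hQr
    rw [hcls]
    congr 1
    have hQC : (Q : ℂ) ≠ 0 := by exact_mod_cast hQ.ne'
    have hrC : (r : ℂ) ≠ 0 := by exact_mod_cast hr.ne'
    have : (Yfun P r Q (qFree Q r) (qPart Q r) u h p : ℂ) / ((Q : ℂ) * r) =
        (Yfun P r Q (qFree Q r) (qPart Q r) u h p' : ℂ) / ((Q : ℂ) * r) + (k : ℂ) := by
      have e1 : (Yfun P r Q (qFree Q r) (qPart Q r) u h p : ℂ) =
          (Yfun P r Q (qFree Q r) (qPart Q r) u h p' : ℂ) + (Q : ℂ) * r * k := by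
        have := congrArg (fun z : ℤ => (z : ℂ)) hk
        push_cast at this
        linear_combination this
      rw [e1]; field_simp
    rw [this, e_add_intCast]
  · have h0 : clsInd P r Q u₀ p = 0 := by
      unfold clsInd; rw [if_neg]; exact fun hh => hco hh.2
    rw [h0, ← hcls, h0, zero_mul, zero_mul]

/-- `gcd(h u, s) ≤ |h|` for `u` prime to `s` and `h ≠ 0`. [folklore] -/
theorem gcd_mul_le_natAbs {h u : ℤ} {s : ℕ} (hh : h ≠ 0) (hu : Int.gcd u s = 1) :
    Int.gcd (h * u) s ≤ h.natAbs := by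
  have hcop : Nat.Coprime u.natAbs s := by
    rw [Nat.coprime_iff_gcd_eq_one]; exact hu
  have : Int.gcd (h * u) s = Nat.gcd h.natAbs s := by
    show Nat.gcd (h * u).natAbs s = _
    rw [Int.natAbs_mul, Nat.Coprime.gcd_mul_right_cancel _ hcop]
  rw [this]
  exact Nat.gcd_le_left _ (Int.natAbs_pos.2 hh)

/-- **L4d — one class of a slice is an incomplete Kloosterman sum over a progression.**
For `0 ≤ cl < Q' = Q r₂`, `r₁ = qFree`, `(u, r₁) = 1`, `h ≠ 0`, `a ≤ b`:
`‖∑_{a<p<b, (p,r)=1, p ≡ cl (Q')} e(h u p̄/r₁)‖ ≤ ((b − a)/Q' + 1) |h|/r₁ + τ(r₁) √r₁ √|h| (1 + log r₁)`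
(the tree's `KI_sum_progression_le` with `p = cl + Q' y`). [folklore] -/
theorem norm_sum_class_hooleyPhase_le {r : ℕ} (hr : 0 < r) (Q : ℕ) (hQ : 0 < Q) {h u : ℤ} (hh : h ≠ 0)
    (hu : Int.gcd u (qFree Q r) = 1) (a b : ℤ) (hab : a ≤ b) {cl : ℤ} (hcl0 : 0 ≤ cl)
    (hclQ : cl < (Q : ℤ) * qPart Q r) :
    ‖∑ p ∈ ((Finset.Ioo a b).filter (fun p : ℤ => Int.gcd p r = 1)).filter
        (fun p : ℤ => p % ((Q : ℤ) * qPart Q r) = cl), hooleyPhase (h * u) (qFree Q r) p‖ ≤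
      (((b - a : ℤ) : ℝ) / ((Q : ℝ) * qPart Q r) + 1) * |(h : ℝ)| / (qFree Q r) +
        (Nat.divisors (qFree Q r)).card * Real.sqrt (qFree Q r) * Real.sqrt |(h : ℝ)| *
          (1 + Real.log (qFree Q r)) := by
  set r₁ : ℕ := qFree Q r with hr₁_def
  set r₂ : ℕ := qPart Q r with hr₂_def
  set Q' : ℤ := (Q : ℤ) * r₂ with hQ'_def
  have hr₁ : 0 < r₁ := qFree_pos hr
  have hr₂ : 0 < r₂ := qPart_pos hr
  have hQ'0 : (0 : ℤ) < Q' := by rw [hQ'_def]; positivity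
  have hrr : (r : ℤ) = (r₁ : ℤ) * r₂ := by exact_mod_cast (qFree_mul_qPart Q r).symm
  have hcopNat : Nat.Coprime (Q * r₂) r₁ := coprime_mul_qPart_qFree Q hr
  clear hQ
  -- nonnegativity of the right-hand side pieces
  have hba : (0 : ℝ) ≤ ((b - a : ℤ) : ℝ) := by exact_mod_cast (sub_nonneg.2 hab)
  have hRHS0 : 0 ≤ (((b - a : ℤ) : ℝ) / ((Q : ℝ) * qPart Q r) + 1) * |(h : ℝ)| / (qFree Q r) +
      (Nat.divisors (qFree Q r)).card * Real.sqrt (qFree Q r) * Real.sqrt |(h : ℝ)| *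
        (1 + Real.log (qFree Q r)) := by
    have : 0 ≤ Real.log (qFree Q r) := Real.log_nonneg (by exact_mod_cast hr₁)
    positivity
  set S := ((Finset.Ioo a b).filter (fun p : ℤ => Int.gcd p r = 1)).filter
    (fun p : ℤ => p % Q' = cl) with hS
  -- the empty cases
  by_cases hclr : Int.gcd cl r₂ = 1
  swap
  · have hempty : S = ∅ := by
      rw [Finset.eq_empty_iff_forall_notMem]
      intro p hp
      simp only [hS, Finset.mem_filter, Finset.mem_Ioo] at hp
      obtain ⟨⟨-, hpr⟩, hpcl⟩ := hp
      apply hclr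
      -- `cl ≡ p (mod r₂)` and `(p, r₂) = 1`
      have hpr₂ : Int.gcd p r₂ = 1 := by
        have hd : Int.gcd p r₂ ∣ Int.gcd p r := by
          rw [hrr]; exact Int.gcd_dvd_gcd_mul_left_right _ _ _
        rw [hpr] at hd; exact Nat.dvd_one.1 hd
      have hmod : cl ≡ p [ZMOD r₂] := by
        have : p % Q' ≡ p [ZMOD Q'] := Int.mod_modEq _ _
        rw [hpcl] at this
        exact this.of_mul_left _
      have e : (cl : ZMod r₂) = (p : ZMod r₂) := (ZMod.intCast_eq_intCast_iff _ _ _).2 hmod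
      have hun : IsUnit (cl : ZMod r₂) := by rw [e]; exact isUnit_intCast_of_gcd_eq_one hpr₂
      rwa [ZMod.coe_int_isUnit_iff_isCoprime, Int.isCoprime_iff_gcd_eq_one, Int.gcd_comm] at hun
    rw [hempty, Finset.sum_empty, norm_zero]
    exact hRHS0
  set y₁ : ℤ := (a - cl) / Q' with hy₁
  set y₂ : ℤ := (b - 1 - cl) / Q' with hy₂
  by_cases hy : y₂ < y₁
  · have hempty : S = ∅ := by
      rw [Finset.eq_empty_iff_forall_notMem]
      intro p hp
      simp only [hS, Finset.mem_filter, Finset.mem_Ioo] at hp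
      obtain ⟨⟨⟨hap, hpb⟩, -⟩, hpcl⟩ := hp
      have hp_eq : p = cl + Q' * (p / Q') := by
        have := Int.emod_def p Q'; rw [hpcl] at this; linarith
      have h1 : y₁ < p / Q' := by
        rw [hy₁, Int.ediv_lt_iff_lt_mul hQ'0]; linarith
      have h2 : p / Q' ≤ y₂ := by
        rw [hy₂, Int.le_ediv_iff_mul_le hQ'0]; linarith
      omega
    rw [hempty, Finset.sum_empty, norm_zero]
    exact hRHS0
  push Not at hy
  -- reindex `p = cl + Q' y`
  have hsum : ∑ p ∈ S, hooleyPhase (h * u) r₁ p =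
      ∑ y ∈ (Finset.Ioc y₁ y₂).filter (fun y : ℤ => Int.gcd (cl + Q' * y) r₁ = 1),
        Complex.exp (2 * Real.pi * Complex.I *
          (((h * u : ℤ) : ℂ) * (((((cl + Q' * y : ℤ) : ZMod r₁)⁻¹).val : ℕ) : ℂ) / (r₁ : ℂ))) := by
    refine Finset.sum_nbij' (fun p : ℤ => p / Q') (fun y : ℤ => cl + Q' * y) ?_ ?_ ?_ ?_ ?_
    · intro p hp
      simp only [hS, Finset.mem_filter, Finset.mem_Ioo] at hp
      obtain ⟨⟨⟨hap, hpb⟩, hpr⟩, hpcl⟩ := hp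
      have hp_eq : p = cl + Q' * (p / Q') := by
        have := Int.emod_def p Q'; rw [hpcl] at this; linarith
      simp only [Finset.mem_filter, Finset.mem_Ioc]
      refine ⟨⟨?_, ?_⟩, ?_⟩
      · rw [hy₁, Int.ediv_lt_iff_lt_mul hQ'0]; linarith
      · rw [hy₂, Int.le_ediv_iff_mul_le hQ'0]; linarith
      · rw [← hp_eq]
        have hd : Int.gcd p r₁ ∣ Int.gcd p r := by
          rw [hrr]; exact Int.gcd_dvd_gcd_mul_right_right _ _ _
        rw [hpr] at hd; exact Nat.dvd_one.1 hd
    · intro y hyy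
      simp only [Finset.mem_filter, Finset.mem_Ioc] at hyy
      obtain ⟨⟨h1, h2⟩, hg⟩ := hyy
      simp only [hS, Finset.mem_filter, Finset.mem_Ioo]
      refine ⟨⟨⟨?_, ?_⟩, ?_⟩, ?_⟩
      · rw [hy₁, Int.ediv_lt_iff_lt_mul hQ'0] at h1; linarith
      · rw [hy₂, Int.le_ediv_iff_mul_le hQ'0] at h2; linarith
      · -- `(cl + Q'y, r₁ r₂) = 1`
        have hg2 : Int.gcd (cl + Q' * y) r₂ = 1 := by
          have hmod : cl + Q' * y ≡ cl [ZMOD r₂] := by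
            have : (r₂ : ℤ) ∣ Q' * y := by rw [hQ'_def]; exact Dvd.dvd.mul_right (dvd_mul_left _ _) _
            simpa using (Int.modEq_iff_dvd.2 (by simpa using this.neg_right) : cl + Q' * y ≡ cl + 0 [ZMOD r₂])
          have e : ((cl + Q' * y : ℤ) : ZMod r₂) = (cl : ZMod r₂) := (ZMod.intCast_eq_intCast_iff _ _ _).2 hmod
          have hun : IsUnit ((cl + Q' * y : ℤ) : ZMod r₂) := by rw [e]; exact isUnit_intCast_of_gcd_eq_one hclr
          rwa [ZMod.coe_int_isUnit_iff_isCoprime, Int.isCoprime_iff_gcd_eq_one, Int.gcd_comm] at hun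
        show Nat.gcd (cl + Q' * y).natAbs r = 1
        have e1 : Nat.gcd (cl + Q' * y).natAbs r₁ = 1 := hg
        have e2 : Nat.gcd (cl + Q' * y).natAbs r₂ = 1 := hg2
        rw [← qFree_mul_qPart Q r]
        exact Nat.Coprime.mul_right e1 e2
      · rw [Int.add_mul_emod_self_left]
        exact Int.emod_eq_of_lt hcl0 hclQ
    · intro p hp
      simp only [hS, Finset.mem_filter] at hp
      have := Int.emod_def p Q'; rw [hp.2] at this; linarith
    · intro y _
      rw [Int.add_mul_ediv_left _ _ hQ'0.ne', Int.ediv_eq_zero_of_lt hcl0 hclQ, zero_add]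
    · intro p hp
      simp only [hS, Finset.mem_filter] at hp
      have hp_eq : cl + Q' * (p / Q') = p := by
        have := Int.emod_def p Q'; rw [hp.2] at this; linarith
      rw [hooleyPhase, hp_eq]
  rw [hsum]
  have hKI := KI_sum_progression_le hr₁ (q := Q * r₂) hcopNat (h * u) cl y₁ y₂ hy
  have hQ'cast : ((Q * r₂ : ℕ) : ℤ) = Q' := by rw [hQ'_def]; push_cast; ring
  rw [hQ'cast] at hKI
  refine hKI.trans ?_
  -- bound the two terms
  have hgcd : (Int.gcd (h * u) r₁ : ℝ) ≤ |(h : ℝ)| := by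
    rw [← Int.cast_abs, Int.abs_eq_natAbs, Int.cast_natCast]
    exact_mod_cast gcd_mul_le_natAbs hh hu
  have hgcd0 : (0 : ℝ) ≤ Int.gcd (h * u) r₁ := Nat.cast_nonneg _
  have hyy : ((y₂ - y₁ : ℤ) : ℝ) ≤ ((b - a : ℤ) : ℝ) / ((Q : ℝ) * qPart Q r) + 1 := by
    have hQ'R : (0 : ℝ) < (Q : ℝ) * qPart Q r := by
      have : (0 : ℝ) < (Q' : ℝ) := by exact_mod_cast hQ'0
      rw [hQ'_def] at this; push_cast at this; exact this
    rw [div_add_one hQ'R.ne', le_div_iff₀ hQ'R]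
    have h1 : Q' * y₂ ≤ b - 1 - cl := by
      have := Int.emod_def (b - 1 - cl) Q'
      have := Int.emod_nonneg (b - 1 - cl) hQ'0.ne'
      rw [hy₂]; linarith
    have h2 : a - cl - Q' + 1 ≤ Q' * y₁ := by
      have := Int.emod_def (a - cl) Q'
      have := Int.emod_lt_of_pos (a - cl) hQ'0
      rw [hy₁]; linarith
    have h3 : Q' * (y₂ - y₁) ≤ (b - a) + Q' := by linarith
    have h3R : ((Q' * (y₂ - y₁) : ℤ) : ℝ) ≤ ((b - a + Q' : ℤ) : ℝ) := by exact_mod_cast h3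
    rw [hQ'_def] at h3R; push_cast at h3R ⊢
    linarith
  have hr₁R : (0 : ℝ) < r₁ := by exact_mod_cast hr₁
  have hlog : 0 ≤ 1 + Real.log r₁ := by
    have : 0 ≤ Real.log r₁ := Real.log_nonneg (by exact_mod_cast hr₁); linarith
  have hyy0 : (0 : ℝ) ≤ ((y₂ - y₁ : ℤ) : ℝ) := by exact_mod_cast (sub_nonneg.2 hy)
  gcongr
  · -- first term
    calc ((y₂ - y₁ : ℤ) : ℝ) / r₁ * Int.gcd (h * u) r₁
        ≤ (((b - a : ℤ) : ℝ) / ((Q : ℝ) * qPart Q r) + 1) / r₁ * |(h : ℝ)| := by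
          gcongr
      _ = (((b - a : ℤ) : ℝ) / ((Q : ℝ) * qPart Q r) + 1) * |(h : ℝ)| / r₁ := by ring

/-- `clsInd p ≠ 0` forces `(P(p, r), Q) = 1`. [folklore] -/
theorem gcd_eq_one_of_clsInd_ne_zero {P : BinQF} {r : ℤ} {Q u₀ : ℕ} {p : ℤ}
    (h : clsInd P r Q u₀ p ≠ 0) : Int.gcd (P.eval p r) Q = 1 := by
  unfold clsInd at h
  by_contra hc
  exact h (if_neg fun hh => hc hh.2)

/-- **L4 — the slice bound** (blueprint §4).  On a slice `r ≥ 1` of a class `P = [A, 2B', C]`,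
with `r₁ = qFree`, `r₂ = qPart`, `Q' = Q r₂`, an interval `(a, b)` on which `P(p, r) > 0` and the
small twist satisfies `‖tw − 1‖ ≤ c`:
`‖∑_{a<p<b, (p,r)=1} clsInd(p) · twW(p)‖ ≤ Q' · (((b − a)/Q' + 1)|h|/r₁ + τ(r₁)√r₁ √|h| (1 + log r₁)) + (b − a) c`.
[folklore] -/
theorem norm_slice_le {P : BinQF} (hB : Even P.b) {r : ℕ} (hr : 0 < r) {Q : ℕ} (hQ : 0 < Q)
    (u₀ : ℕ) {h : ℤ} (hh : h ≠ 0) (a b : ℤ) (hab : a ≤ b) {c : ℝ} (hc : 0 ≤ c)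
    (hpos : ∀ p ∈ Finset.Ioo a b, 0 < P.eval p r)
    (htw : ∀ p ∈ Finset.Ioo a b, ‖tw P r Q h p - 1‖ ≤ c) :
    ‖∑ p ∈ (Finset.Ioo a b).filter (fun p : ℤ => Int.gcd p r = 1), clsInd P r Q u₀ p * twW P r Q h p‖ ≤
      ((Q : ℝ) * qPart Q r) *
          ((((b - a : ℤ) : ℝ) / ((Q : ℝ) * qPart Q r) + 1) * |(h : ℝ)| / (qFree Q r) +
            (Nat.divisors (qFree Q r)).card * Real.sqrt (qFree Q r) * Real.sqrt |(h : ℝ)| *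
              (1 + Real.log (qFree Q r))) +
        ((b - a : ℤ) : ℝ) * c := by
  obtain ⟨u, hu, hu1⟩ := exists_inv_modEq Q hr
  set r₁ : ℕ := qFree Q r with hr₁_def
  set r₂ : ℕ := qPart Q r with hr₂_def
  set Q' : ℤ := (Q : ℤ) * r₂ with hQ'_def
  have hQ'0 : (0 : ℤ) < Q' := by rw [hQ'_def]; have := qPart_pos (Q := Q) hr; positivity
  set S := (Finset.Ioo a b).filter (fun p : ℤ => Int.gcd p r = 1) with hS
  set Φ : ℤ → ℂ := fun p => clsInd P r Q u₀ p * e ((Yfun P r Q r₁ r₂ u h p : ℂ) / ((Q : ℂ) * r))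
    with hΦ
  set K : ℤ → ℂ := fun p => hooleyPhase (h * u) r₁ p with hK
  have hΦnorm : ∀ p, ‖Φ p‖ ≤ 1 := by
    intro p
    rw [hΦ]; dsimp only
    rw [norm_mul]
    have h1 := norm_clsInd_le P r Q u₀ p
    have h2 : ‖e ((Yfun P r Q r₁ r₂ u h p : ℂ) / ((Q : ℂ) * r))‖ = 1 := by
      rw [show ((Yfun P r Q r₁ r₂ u h p : ℂ) / ((Q : ℂ) * r)) =
        (((Yfun P r Q r₁ r₂ u h p : ℝ) / ((Q : ℝ) * r) : ℝ) : ℂ) by push_cast; ring]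
      exact norm_e_ofReal _
    rw [h2, mul_one]; exact h1
  have hKnorm : ∀ p, ‖K p‖ = 1 := fun p => by rw [hK]; exact Iwaniec1978.norm_hooleyPhase _ _ _
  -- pointwise factorisation
  have hpt : ∀ p ∈ S, clsInd P r Q u₀ p * twW P r Q h p = Φ p * K p * tw P r Q h p := by
    intro p hp
    simp only [hS, Finset.mem_filter] at hp
    by_cases h0 : clsInd P r Q u₀ p = 0
    · rw [hΦ]; dsimp only; rw [h0]; ring
    · rw [twW_eq hB hr hQ u hp.2 (hpos p hp.1) (gcd_eq_one_of_clsInd_ne_zero h0) h, hΦ, hK]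
      ring
  rw [Finset.sum_congr rfl hpt]
  -- split off the twist
  have hsplit : ∀ p, Φ p * K p * tw P r Q h p = Φ p * K p + Φ p * K p * (tw P r Q h p - 1) := by
    intro p; ring
  simp_rw [hsplit]
  rw [Finset.sum_add_distrib]
  refine (norm_add_le _ _).trans (add_le_add ?_ ?_)
  swap
  · -- the twist part
    calc ‖∑ p ∈ S, Φ p * K p * (tw P r Q h p - 1)‖ ≤ ∑ p ∈ S, ‖Φ p * K p * (tw P r Q h p - 1)‖ :=
          norm_sum_le _ _
      _ ≤ ∑ p ∈ S, c := by
          refine Finset.sum_le_sum fun p hp => ?_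
          rw [norm_mul, norm_mul, hKnorm, mul_one]
          have := htw p (Finset.mem_filter.1 hp).1
          calc ‖Φ p‖ * ‖tw P r Q h p - 1‖ ≤ 1 * c :=
                mul_le_mul (hΦnorm p) this (norm_nonneg _) zero_le_one
            _ = c := one_mul c
      _ = S.card * c := by rw [Finset.sum_const, nsmul_eq_mul]
      _ ≤ ((b - a : ℤ) : ℝ) * c := by
          refine mul_le_mul_of_nonneg_right ?_ hc
          have h1 : S.card ≤ (Finset.Ioo a b).card := Finset.card_filter_le _ _
          have h2 : ((Finset.Ioo a b).card : ℤ) ≤ b - a := by rw [Int.card_Ioo]; omega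
          have h3 : (S.card : ℤ) ≤ b - a := le_trans (by exact_mod_cast h1) h2
          exact_mod_cast h3
  · -- the main part: group by classes modulo `Q'`
    have hmaps : ∀ p ∈ S, p % Q' ∈ Finset.Ico (0 : ℤ) Q' := fun p _ =>
      Finset.mem_Ico.2 ⟨Int.emod_nonneg _ hQ'0.ne', Int.emod_lt_of_pos _ hQ'0⟩
    rw [← Finset.sum_fiberwise_of_maps_to hmaps]
    have hclass : ∀ cl ∈ Finset.Ico (0 : ℤ) Q',
        ‖∑ p ∈ S.filter (fun p => p % Q' = cl), Φ p * K p‖ ≤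
          (((b - a : ℤ) : ℝ) / ((Q : ℝ) * qPart Q r) + 1) * |(h : ℝ)| / (qFree Q r) +
            (Nat.divisors (qFree Q r)).card * Real.sqrt (qFree Q r) * Real.sqrt |(h : ℝ)| *
              (1 + Real.log (qFree Q r)) := by
      intro cl hcl
      obtain ⟨hcl0, hclQ⟩ := Finset.mem_Ico.1 hcl
      have hKI := norm_sum_class_hooleyPhase_le hr Q hQ hh hu1 a b hab hcl0 hclQ
      rcases (S.filter (fun p => p % Q' = cl)).eq_empty_or_nonempty with hemp | ⟨p₀, hp₀⟩
      · rw [hemp, Finset.sum_empty, norm_zero]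
        exact le_trans (norm_nonneg _) hKI
      · -- `Φ` is constant on the class
        have hconst : ∀ p ∈ S.filter (fun p => p % Q' = cl), Φ p = Φ p₀ := by
          intro p hp
          simp only [hS, Finset.mem_filter] at hp hp₀
          have hmod : p ≡ p₀ [ZMOD Q'] := by
            have h1 : p % Q' ≡ p [ZMOD Q'] := Int.mod_modEq _ _
            have h2 : p₀ % Q' ≡ p₀ [ZMOD Q'] := Int.mod_modEq _ _
            rw [hp.2] at h1; rw [hp₀.2] at h2
            exact h1.symm.trans h2
          exact clsInd_mul_e_eq_of_modEq hr hQ u₀ hu h hp.1.2 hp₀.1.2 hmod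
        rw [Finset.sum_congr rfl fun p hp => by rw [hconst p hp], ← Finset.mul_sum, norm_mul]
        calc ‖Φ p₀‖ * ‖∑ p ∈ S.filter (fun p => p % Q' = cl), K p‖
            ≤ 1 * ‖∑ p ∈ S.filter (fun p => p % Q' = cl), K p‖ :=
              mul_le_mul_of_nonneg_right (hΦnorm p₀) (norm_nonneg _)
          _ ≤ _ := by rw [one_mul]; exact hKI
    calc ‖∑ cl ∈ Finset.Ico (0 : ℤ) Q', ∑ p ∈ S.filter (fun p => p % Q' = cl), Φ p * K p‖
        ≤ ∑ cl ∈ Finset.Ico (0 : ℤ) Q', ‖∑ p ∈ S.filter (fun p => p % Q' = cl), Φ p * K p‖ :=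
          norm_sum_le _ _
      _ ≤ ∑ cl ∈ Finset.Ico (0 : ℤ) Q', ((((b - a : ℤ) : ℝ) / ((Q : ℝ) * qPart Q r) + 1) * |(h : ℝ)| / (qFree Q r) +
            (Nat.divisors (qFree Q r)).card * Real.sqrt (qFree Q r) * Real.sqrt |(h : ℝ)| *
              (1 + Real.log (qFree Q r))) := Finset.sum_le_sum hclass
      _ = ((Q : ℝ) * qPart Q r) * _ := by
          rw [Finset.sum_const, nsmul_eq_mul, Int.card_Ico, sub_zero, hQ'_def]
          congr 1
          have : (0 : ℤ) ≤ (Q : ℤ) * r₂ := hQ'0.le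
          rw [show (((Q : ℤ) * r₂).toNat : ℝ) = (((Q : ℤ) * r₂ : ℤ) : ℝ) by exact_mod_cast Int.toNat_of_nonneg this]
          push_cast; ring

/-! ### Rankin's bound for `Q`-smooth numbers (the slice indices `r₂`) -/

/-- `∑_{k < K} x^k ≤ (1 − x)⁻¹` for `0 ≤ x < 1`. [folklore] -/
theorem geom_sum_le_inv {x : ℝ} (hx0 : 0 ≤ x) (hx1 : x < 1) (K : ℕ) :
    ∑ k ∈ range K, x ^ k ≤ (1 - x)⁻¹ := by
  have h1 : 0 < 1 - x := by linarith
  rw [inv_eq_one_div, le_div_iff₀ h1, geom_sum_mul_neg]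
  have : 0 ≤ x ^ K := pow_nonneg hx0 K
  linarith

/-- **Rankin's bound for the `Q`-smooth numbers up to `R`**:
`#{1 ≤ s ≤ R : s ∣ Q^R} ≤ R^{1/8} · Q^4`. [folklore] -/
theorem card_qSmooth_le {Q : ℕ} (hQ : 0 < Q) (R : ℕ) :
    (((Icc 1 R).filter (fun s => s ∣ Q ^ R)).card : ℝ) ≤ (R : ℝ) ^ (1 / 8 : ℝ) * (Q : ℝ) ^ 4 := by
  set ε : ℝ := 1 / 8 with hε
  set T := (Icc 1 R).filter (fun s => s ∣ Q ^ R) with hT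
  have hmemT : ∀ s ∈ T, 1 ≤ s ∧ s ≤ R ∧ s ∣ Q ^ R := fun s hs => by
    simp only [hT, mem_filter, mem_Icc] at hs; exact ⟨hs.1.1, hs.1.2, hs.2⟩
  rcases Nat.eq_zero_or_pos R with hR0 | hR
  · have : T = ∅ := by
      rw [Finset.eq_empty_iff_forall_notMem]; intro s hs; have := hmemT s hs; omega
    rw [this]; simp; positivity
  have hR' : (0 : ℝ) < R := by exact_mod_cast hR
  have hsubQ : ∀ {t : ℕ}, t ∣ Q ^ R → t.primeFactors ⊆ Q.primeFactors := fun ht => by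
    rw [← Nat.primeFactors_pow Q hR.ne']
    exact Nat.primeFactors_mono ht (pow_ne_zero _ hQ.ne')
  -- Step 1: `#T ≤ R^ε ∑_{s ∈ T} s^{-ε}`
  have h1 : (T.card : ℝ) ≤ (R : ℝ) ^ ε * ∑ s ∈ T, (s : ℝ) ^ (-ε) := by
    rw [Finset.mul_sum]
    have : (T.card : ℝ) = ∑ _s ∈ T, (1 : ℝ) := by simp
    rw [this]
    refine Finset.sum_le_sum fun s hs => ?_
    obtain ⟨hs1, hsR, -⟩ := hmemT s hs
    have hs' : (0 : ℝ) < s := by exact_mod_cast hs1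
    rw [Real.rpow_neg hs'.le, ← div_eq_mul_inv, ← Real.div_rpow hR'.le hs'.le]
    exact Real.one_le_rpow ((one_le_div hs').2 (by exact_mod_cast hsR)) (by norm_num)
  -- Step 2: multiplicativity
  set ι := {p // p ∈ Q.primeFactors}
  have hι : ∀ p : ι, Nat.Prime p.1 := fun p => Nat.prime_of_mem_primeFactors p.2
  set g : ι → ℕ → ℝ := fun p k => ((p.1 : ℝ) ^ (-ε)) ^ k with hg
  have hg0 : ∀ p k, 0 ≤ g p k := fun p k => by rw [hg]; positivity
  have hfac : ∀ s ∈ T, ((s : ℝ)) ^ (-ε) = ∏ p : ι, g p (s.factorization p.1) := by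
    intro s hs
    obtain ⟨hs1, hsR, hsQ⟩ := hmemT s hs
    have hs0 : s ≠ 0 := by omega
    have hsub : s.primeFactors ⊆ Q.primeFactors := hsubQ hsQ
    -- `s = ∏_{p ∈ Q.primeFactors} p^{v_p(s)}`
    have hprod : (∏ p ∈ Q.primeFactors, p ^ s.factorization p) = s := by
      have e1 : (∏ p ∈ s.primeFactors, p ^ s.factorization p) = s := by
        conv_rhs => rw [← Nat.prod_factorization_pow_eq_self hs0]
        rw [Finsupp.prod, Nat.support_factorization]
      have e2 : (∏ p ∈ s.primeFactors, p ^ s.factorization p) =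
          ∏ p ∈ Q.primeFactors, p ^ s.factorization p :=
        Finset.prod_subset hsub (fun p hp hps => by
          rw [Nat.factorization_eq_zero_of_not_dvd (fun h => hps (Nat.mem_primeFactors.2
            ⟨Nat.prime_of_mem_primeFactors hp, h, hs0⟩)), pow_zero])
      rw [← e2, e1]
    have hprodR : (s : ℝ) = ∏ p ∈ Q.primeFactors, ((p : ℝ) ^ (s.factorization p : ℕ)) := by
      conv_lhs => rw [← hprod]
      push_cast
      rfl
    rw [hprodR, ← Real.finsetProd_rpow _ _ (fun p _ => by positivity), ← Finset.prod_coe_sort]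
    refine Finset.prod_congr rfl fun p _ => ?_
    rw [hg]; dsimp only
    rw [← Real.rpow_natCast, ← Real.rpow_natCast, ← Real.rpow_mul (by positivity),
      ← Real.rpow_mul (by positivity), mul_comm]
  set emap : ℕ → (ι → ℕ) := fun s => fun p : ι => s.factorization p.1 with hemap
  have hinj : Set.InjOn emap T := by
    intro s hs s' hs' heq
    obtain ⟨hs1, -, hsQ⟩ := hmemT s hs
    obtain ⟨hs1', -, hsQ'⟩ := hmemT s' hs'
    apply Nat.factorization_inj (show s ≠ 0 by omega) (show s' ≠ 0 by omega)
    ext p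
    by_cases hp : p ∈ Q.primeFactors
    · exact congrFun heq ⟨p, hp⟩
    · have z : ∀ {t : ℕ}, 1 ≤ t → t ∣ Q ^ R → t.factorization p = 0 := by
        intro t ht htQ
        by_cases hpp : p.Prime
        · exact Nat.factorization_eq_zero_of_not_dvd fun h => hp (hsubQ htQ (Nat.mem_primeFactors.2
            ⟨hpp, h, by omega⟩))
        · exact Nat.factorization_eq_zero_of_not_prime _ hpp
      rw [z hs1 hsQ, z hs1' hsQ']
  have h2 : ∑ s ∈ T, (s : ℝ) ^ (-ε) ≤ ∏ p : ι, ∑ k ∈ range (R + 1), g p k := by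
    rw [Finset.sum_congr rfl hfac, ← Finset.sum_prod_piFinset]
    have himg : T.image emap ⊆ Fintype.piFinset fun _ : ι => range (R + 1) := by
      intro f hf
      rw [Finset.mem_image] at hf
      obtain ⟨s, hs, rfl⟩ := hf
      obtain ⟨hs1, hsR, -⟩ := hmemT s hs
      rw [Fintype.mem_piFinset]
      intro p
      rw [mem_range]
      exact lt_of_lt_of_le (Nat.factorization_lt p.1 (by omega)) (by omega)
    calc ∑ s ∈ T, ∏ p : ι, g p (s.factorization p.1) = ∑ f ∈ T.image emap, ∏ p : ι, g p (f p) := by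
          rw [Finset.sum_image hinj]
      _ ≤ ∑ f ∈ Fintype.piFinset (fun _ : ι => range (R + 1)), ∏ p : ι, g p (f p) :=
          Finset.sum_le_sum_of_subset_of_nonneg himg fun f _ _ => Finset.prod_nonneg fun p _ => hg0 p _
  -- Step 3: each factor is `≤ 16`
  have h16 : ∀ p : ι, ∑ k ∈ range (R + 1), g p k ≤ 16 := by
    intro p
    have hp2 : (2 : ℝ) ≤ p.1 := by exact_mod_cast (hι p).two_le
    set x : ℝ := (p.1 : ℝ) ^ (-ε) with hx
    have hx0 : 0 ≤ x := by rw [hx]; positivity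
    have hxle : x ≤ (2 : ℝ) ^ (-ε) := by
      rw [hx]
      exact Real.rpow_le_rpow_of_nonpos (by norm_num) hp2 (by rw [hε]; norm_num)
    have h2ε : (2 : ℝ) ^ (-ε) ≤ 15 / 16 := by
      -- `(2^{-1/8})^8 = 1/2 < (15/16)^8`
      by_contra hlt
      push Not at hlt
      have h8 : ((15 : ℝ) / 16) ^ (8 : ℕ) < ((2 : ℝ) ^ (-ε)) ^ (8 : ℕ) :=
        pow_lt_pow_left₀ hlt (by norm_num) (by norm_num)
      rw [← Real.rpow_natCast ((2 : ℝ) ^ (-ε)), ← Real.rpow_mul (by norm_num), hε] at h8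
      norm_num at h8
    have hx1 : x < 1 := by linarith
    calc ∑ k ∈ range (R + 1), g p k = ∑ k ∈ range (R + 1), x ^ k := by rw [hg]
      _ ≤ (1 - x)⁻¹ := geom_sum_le_inv hx0 hx1 _
      _ ≤ (1 - 15 / 16)⁻¹ := by
          apply inv_anti₀ (by norm_num); linarith
      _ = 16 := by norm_num
  have h3 : ∏ p : ι, ∑ k ∈ range (R + 1), g p k ≤ (16 : ℝ) ^ Q.primeFactors.card := by
    calc ∏ p : ι, ∑ k ∈ range (R + 1), g p k ≤ ∏ _p : ι, (16 : ℝ) :=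
          Finset.prod_le_prod (fun p _ => Finset.sum_nonneg fun k _ => hg0 p k) (fun p _ => h16 p)
      _ = (16 : ℝ) ^ Q.primeFactors.card := by
          rw [Finset.prod_const, Finset.card_univ, Fintype.card_coe]
  -- Step 4: `16^{ω(Q)} ≤ Q^4`
  have h4 : (16 : ℝ) ^ Q.primeFactors.card ≤ (Q : ℝ) ^ 4 := by
    have hlog := BombieriSieve.card_primeFactors_le_log Q
    calc (16 : ℝ) ^ Q.primeFactors.card ≤ (16 : ℝ) ^ Nat.log 2 Q :=
          pow_le_pow_right₀ (by norm_num) hlog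
      _ = ((2 : ℝ) ^ Nat.log 2 Q) ^ 4 := by rw [← pow_mul, mul_comm, pow_mul]; norm_num
      _ ≤ (Q : ℝ) ^ 4 := by
          gcongr
          exact_mod_cast Nat.pow_log_le_self 2 hQ.ne'
  calc (T.card : ℝ) ≤ (R : ℝ) ^ ε * ∑ s ∈ T, (s : ℝ) ^ (-ε) := h1
    _ ≤ (R : ℝ) ^ ε * (Q : ℝ) ^ 4 := by
        refine mul_le_mul_of_nonneg_left (h2.trans (h3.trans h4)) (by positivity)


/-- `qPart Q r` lies in the `Q`-smooth numbers up to `R` for `1 ≤ r ≤ R`. [folklore] -/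
theorem qPart_mem_qSmooth {Q r R : ℕ} (hr : 1 ≤ r) (hrR : r ≤ R) :
    qPart Q r ∈ (Icc 1 R).filter (fun s => s ∣ Q ^ R) := by
  rw [Finset.mem_filter, Finset.mem_Icc]
  refine ⟨⟨qPart_pos hr, (Nat.le_of_dvd hr (qPart_dvd Q r)).trans hrR⟩, ?_⟩
  exact (Nat.gcd_dvd_right _ _).trans (pow_dvd_pow Q hrR)

/-- **Summation over slices through `r = r₁ r₂`**: for `F ≥ 0`,
`∑_{r ≤ R} F(r₂(r), r₁(r)) ≤ ∑_{s ≤ R, s ∣ Q^R} ∑_{t ≤ R/s} F(s, t)`. [folklore] -/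
theorem sum_qParts_le {Q : ℕ} (R : ℕ) (F : ℕ → ℕ → ℝ) (hF : ∀ s t, 0 ≤ F s t) :
    ∑ r ∈ Icc 1 R, F (qPart Q r) (qFree Q r) ≤
      ∑ s ∈ (Icc 1 R).filter (fun s => s ∣ Q ^ R), ∑ t ∈ Icc 1 (R / s), F s t := by
  have hmaps : ∀ r ∈ Icc 1 R, qPart Q r ∈ (Icc 1 R).filter (fun s => s ∣ Q ^ R) := fun r hr => by
    rw [Finset.mem_Icc] at hr; exact qPart_mem_qSmooth hr.1 hr.2
  rw [← Finset.sum_fiberwise_of_maps_to hmaps]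
  refine Finset.sum_le_sum fun s hs => ?_
  have hs1 : 1 ≤ s := (Finset.mem_Icc.1 (Finset.mem_filter.1 hs).1).1
  -- in the fibre `qPart r = s`, `r ↦ qFree r = r / s` is injective into `Icc 1 (R/s)`
  have hinj : Set.InjOn (fun r => qFree Q r) ((Icc 1 R).filter (fun r => qPart Q r = s)) := by
    intro r hr r' hr' heq
    simp only [Finset.coe_filter, Set.mem_setOf_eq] at hr hr'
    have e1 := qFree_mul_qPart Q r
    have e2 := qFree_mul_qPart Q r'
    rw [hr.2] at e1; rw [hr'.2] at e2
    have : qFree Q r * s = qFree Q r' * s := by rw [show qFree Q r = qFree Q r' from heq]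
    omega
  calc ∑ r ∈ (Icc 1 R).filter (fun r => qPart Q r = s), F (qPart Q r) (qFree Q r)
      = ∑ r ∈ (Icc 1 R).filter (fun r => qPart Q r = s), F s (qFree Q r) := by
        refine Finset.sum_congr rfl fun r hr => ?_
        rw [(Finset.mem_filter.1 hr).2]
    _ = ∑ t ∈ ((Icc 1 R).filter (fun r => qPart Q r = s)).image (fun r => qFree Q r), F s t := by
        rw [Finset.sum_image hinj]
    _ ≤ ∑ t ∈ Icc 1 (R / s), F s t := by
        refine Finset.sum_le_sum_of_subset_of_nonneg ?_ (fun t _ _ => hF s t)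
        intro t ht
        rw [Finset.mem_image] at ht
        obtain ⟨r, hr, rfl⟩ := ht
        simp only [Finset.mem_filter, Finset.mem_Icc] at hr
        obtain ⟨⟨hr1, hrR⟩, hrs⟩ := hr
        rw [Finset.mem_Icc]
        refine ⟨qFree_pos hr1, ?_⟩
        rw [Nat.le_div_iff_mul_le hs1]
        have := qFree_mul_qPart Q r
        rw [hrs] at this
        omega

/-! ### L5 — the class bound (explicit, uniform in `Q, u₀, h`) -/

/-- The twisted weight on FORMS: `W(R) = 1[A_R ≡ u₀ (Q), (A_R, Q) = 1] · e(h (B_R/2)/(Q A_R)) ·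
e(−h Ā_R (B_R/2)/Q)`. [folklore] -/
def Wf (Q u₀ : ℕ) (h : ℤ) (R : BinQF) : ℂ :=
  (if (R.a ≡ u₀ [ZMOD Q] ∧ Int.gcd R.a Q = 1) then (1 : ℂ) else 0) *
    (e ((h : ℂ) * ((R.b / 2 : ℤ) : ℂ) / ((Q : ℂ) * (R.a : ℂ))) *
      e (-((h : ℂ) * mbarOf Q R.a * ((R.b / 2 : ℤ) : ℂ)) / Q))

/-- `W(vecForm P (p, r)) = clsInd · twW`. [folklore] -/
theorem Wf_vecForm (P : BinQF) (Q u₀ : ℕ) (h : ℤ) {p r : ℤ} (hv : Int.gcd p r = 1) :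
    Wf Q u₀ h (vecForm P (p, r)) = clsInd P r Q u₀ p * twW P r Q h p := by
  rw [Wf, clsInd, twW, vecForm_a P (v := (p, r)) hv]

/-- `‖W(R)‖ ≤ 1`. [folklore] -/
theorem norm_Wf_le (Q u₀ : ℕ) (h : ℤ) (R : BinQF) : ‖Wf Q u₀ h R‖ ≤ 1 := by
  rw [Wf, norm_mul, norm_mul]
  have h1 : ‖(if (R.a ≡ u₀ [ZMOD Q] ∧ Int.gcd R.a Q = 1) then (1 : ℂ) else 0)‖ ≤ 1 := by
    split_ifs <;> simp
  have h2 : ‖e ((h : ℂ) * ((R.b / 2 : ℤ) : ℂ) / ((Q : ℂ) * (R.a : ℂ)))‖ = 1 := by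
    rw [show ((h : ℂ) * ((R.b / 2 : ℤ) : ℂ) / ((Q : ℂ) * (R.a : ℂ))) =
      (((h : ℝ) * ((R.b / 2 : ℤ) : ℝ) / ((Q : ℝ) * (R.a : ℝ)) : ℝ) : ℂ) by push_cast; ring]
    exact norm_e_ofReal _
  have h3 : ‖e (-((h : ℂ) * mbarOf Q R.a * ((R.b / 2 : ℤ) : ℂ)) / Q)‖ = 1 := by
    rw [show (-((h : ℂ) * mbarOf Q R.a * ((R.b / 2 : ℤ) : ℂ)) / Q) =
      ((-((h : ℝ) * mbarOf Q R.a * ((R.b / 2 : ℤ) : ℝ)) / Q : ℝ) : ℂ) by push_cast; ring]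
    exact norm_e_ofReal _
  rw [h2, h3, mul_one, mul_one]; exact h1

/-- `R^α ≤ c^α N^{α/2}` from `R ≤ c √N`. [folklore] -/
theorem rpow_le_of_le_mul_sqrt {R c N : ℝ} (hR0 : 0 ≤ R) (hc : 0 ≤ c) (hN : 0 ≤ N) (h : R ≤ c * Real.sqrt N)
    {α : ℝ} (hα : 0 ≤ α) : R ^ α ≤ c ^ α * N ^ (α / 2) := by
  calc R ^ α ≤ (c * Real.sqrt N) ^ α := Real.rpow_le_rpow hR0 h hα
    _ = c ^ α * N ^ (α / 2) := by
        rw [Real.mul_rpow hc (Real.sqrt_nonneg _), Real.sqrt_eq_rpow, ← Real.rpow_mul hN]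
        congr 2; ring

/-- `T1`: `∑_{r ≤ R} r₂/r ≤ #S_Q(R) · (1 + log R)`. [folklore] -/
theorem sum_qPart_div_le (Q R : ℕ) :
    ∑ r ∈ Icc 1 R, (qPart Q r : ℝ) / r ≤
      ((Icc 1 R).filter (fun s => s ∣ Q ^ R)).card * (1 + Real.log R) := by
  set S := (Icc 1 R).filter (fun s => s ∣ Q ^ R) with hS
  have hSmem : ∀ s ∈ S, 1 ≤ s ∧ s ≤ R := fun s hs => by
    have := Finset.mem_Icc.1 (Finset.mem_filter.1 hs).1; exact ⟨this.1, this.2⟩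
  have hlogdiv : ∀ s ∈ S, 1 + Real.log ((R / s : ℕ) : ℝ) ≤ 1 + Real.log R := by
    intro s hs
    rcases Nat.eq_zero_or_pos (R / s) with h0 | h0
    · rw [h0]; simp
      rcases Nat.eq_zero_or_pos R with h0' | h0'
      · rw [h0']; simp
      · exact Real.log_nonneg (by exact_mod_cast h0')
    · have h1 : ((R / s : ℕ) : ℝ) ≤ R := by exact_mod_cast Nat.div_le_self R s
      linarith [Real.log_le_log (by exact_mod_cast h0) h1]
  have := sum_qParts_le (Q := Q) R (fun (s t : ℕ) => if t = 0 then (0 : ℝ) else (s : ℝ) / ((t : ℝ) * s))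
    (fun s t => by split_ifs <;> positivity)
  have hl : ∑ r ∈ Icc 1 R, (qPart Q r : ℝ) / r =
      ∑ r ∈ Icc 1 R, (fun (s t : ℕ) => if t = 0 then (0 : ℝ) else (s : ℝ) / ((t : ℝ) * s)) (qPart Q r) (qFree Q r) := by
    refine Finset.sum_congr rfl fun r hr => ?_
    have hr1 := (Finset.mem_Icc.1 hr).1
    dsimp only
    rw [if_neg (qFree_pos (Q := Q) hr1).ne']
    congr 1; exact_mod_cast (qFree_mul_qPart Q r).symm
  rw [hl]
  refine this.trans ?_
  calc ∑ s ∈ S, ∑ t ∈ Icc 1 (R / s), (if t = 0 then (0 : ℝ) else (s : ℝ) / ((t : ℝ) * s))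
      = ∑ s ∈ S, ∑ t ∈ Icc 1 (R / s), (t : ℝ)⁻¹ := by
        refine Finset.sum_congr rfl fun s hs => Finset.sum_congr rfl fun t ht => ?_
        have ht1 := (Finset.mem_Icc.1 ht).1
        have hs1 := (hSmem s hs).1
        rw [if_neg (by omega)]
        have : (s : ℝ) ≠ 0 := by exact_mod_cast (show s ≠ 0 by omega)
        field_simp
    _ ≤ ∑ s ∈ S, (1 + Real.log R) := Finset.sum_le_sum fun s hs =>
        (Lichtman2020.sum_Icc_inv_le_one_add_log _).trans (hlogdiv s hs)
    _ = S.card * (1 + Real.log R) := by rw [Finset.sum_const, nsmul_eq_mul]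

/-- `T2`: `∑_{r ≤ R} r₂²/r ≤ R · #S_Q(R) · (1 + log R)`. [folklore] -/
theorem sum_qPart_sq_div_le (Q R : ℕ) :
    ∑ r ∈ Icc 1 R, (qPart Q r : ℝ) ^ 2 / r ≤
      R * (((Icc 1 R).filter (fun s => s ∣ Q ^ R)).card * (1 + Real.log R)) := by
  set S := (Icc 1 R).filter (fun s => s ∣ Q ^ R) with hS
  have hR0 : (0 : ℝ) ≤ R := Nat.cast_nonneg _
  have hSmem : ∀ s ∈ S, 1 ≤ s ∧ s ≤ R := fun s hs => by
    have := Finset.mem_Icc.1 (Finset.mem_filter.1 hs).1; exact ⟨this.1, this.2⟩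
  have hlogdiv : ∀ s ∈ S, 1 + Real.log ((R / s : ℕ) : ℝ) ≤ 1 + Real.log R := by
    intro s hs
    rcases Nat.eq_zero_or_pos (R / s) with h0 | h0
    · rw [h0]; simp
      rcases Nat.eq_zero_or_pos R with h0' | h0'
      · rw [h0']; simp
      · exact Real.log_nonneg (by exact_mod_cast h0')
    · have h1 : ((R / s : ℕ) : ℝ) ≤ R := by exact_mod_cast Nat.div_le_self R s
      linarith [Real.log_le_log (by exact_mod_cast h0) h1]
  have := sum_qParts_le (Q := Q) R (fun (s t : ℕ) => if t = 0 then (0 : ℝ) else (s : ℝ) ^ 2 / ((t : ℝ) * s))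
    (fun s t => by split_ifs <;> positivity)
  have hl : ∑ r ∈ Icc 1 R, (qPart Q r : ℝ) ^ 2 / r =
      ∑ r ∈ Icc 1 R, (fun (s t : ℕ) => if t = 0 then (0 : ℝ) else (s : ℝ) ^ 2 / ((t : ℝ) * s)) (qPart Q r) (qFree Q r) := by
    refine Finset.sum_congr rfl fun r hr => ?_
    have hr1 := (Finset.mem_Icc.1 hr).1
    dsimp only
    rw [if_neg (qFree_pos (Q := Q) hr1).ne']
    congr 1; exact_mod_cast (qFree_mul_qPart Q r).symm
  rw [hl]
  refine this.trans ?_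
  calc ∑ s ∈ S, ∑ t ∈ Icc 1 (R / s), (if t = 0 then (0 : ℝ) else (s : ℝ) ^ 2 / ((t : ℝ) * s))
      = ∑ s ∈ S, (s : ℝ) * ∑ t ∈ Icc 1 (R / s), (t : ℝ)⁻¹ := by
        refine Finset.sum_congr rfl fun s hs => ?_
        rw [Finset.mul_sum]
        refine Finset.sum_congr rfl fun t ht => ?_
        have ht1 := (Finset.mem_Icc.1 ht).1
        have hs1 := (hSmem s hs).1
        rw [if_neg (by omega)]
        have : (s : ℝ) ≠ 0 := by exact_mod_cast (show s ≠ 0 by omega)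
        field_simp
    _ ≤ ∑ s ∈ S, (R : ℝ) * (1 + Real.log R) := Finset.sum_le_sum fun s hs => by
        have hsR : (s : ℝ) ≤ R := by exact_mod_cast (hSmem s hs).2
        exact mul_le_mul hsR ((Lichtman2020.sum_Icc_inv_le_one_add_log _).trans (hlogdiv s hs))
          (Finset.sum_nonneg fun t _ => by positivity) hR0
    _ = R * (S.card * (1 + Real.log R)) := by rw [Finset.sum_const, nsmul_eq_mul]; ring

/-- `T3`: `∑_{r ≤ R} r₂ τ(r₁) √r₁ ≤ #S_Q(R) · R√R (1 + log R)`. [folklore] -/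
theorem sum_qPart_mul_divisors_sqrt_le (Q R : ℕ) :
    ∑ r ∈ Icc 1 R, (qPart Q r : ℝ) * ((Nat.divisors (qFree Q r)).card * Real.sqrt (qFree Q r)) ≤
      ((Icc 1 R).filter (fun s => s ∣ Q ^ R)).card * ((R : ℝ) * Real.sqrt R * (1 + Real.log R)) := by
  set S := (Icc 1 R).filter (fun s => s ∣ Q ^ R) with hS
  have hR0 : (0 : ℝ) ≤ R := Nat.cast_nonneg _
  have hSmem : ∀ s ∈ S, 1 ≤ s ∧ s ≤ R := fun s hs => by
    have := Finset.mem_Icc.1 (Finset.mem_filter.1 hs).1; exact ⟨this.1, this.2⟩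
  have hlogdiv : ∀ s ∈ S, 1 + Real.log ((R / s : ℕ) : ℝ) ≤ 1 + Real.log R := by
    intro s hs
    rcases Nat.eq_zero_or_pos (R / s) with h0 | h0
    · rw [h0]; simp
      rcases Nat.eq_zero_or_pos R with h0' | h0'
      · rw [h0']; simp
      · exact Real.log_nonneg (by exact_mod_cast h0')
    · have h1 : ((R / s : ℕ) : ℝ) ≤ R := by exact_mod_cast Nat.div_le_self R s
      linarith [Real.log_le_log (by exact_mod_cast h0) h1]
  have := sum_qParts_le (Q := Q) R (fun (s t : ℕ) => (s : ℝ) * ((Nat.divisors t).card * Real.sqrt t))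
    (fun s t => by positivity)
  refine this.trans ?_
  calc ∑ s ∈ S, ∑ t ∈ Icc 1 (R / s), (s : ℝ) * ((Nat.divisors t).card * Real.sqrt t)
      = ∑ s ∈ S, (s : ℝ) * ∑ t ∈ Icc 1 (R / s), ((Nat.divisors t).card * Real.sqrt t) := by
        refine Finset.sum_congr rfl fun s _ => by rw [Finset.mul_sum]
    _ ≤ ∑ s ∈ S, (R : ℝ) * Real.sqrt R * (1 + Real.log R) := Finset.sum_le_sum fun s hs => by
        have hs1 := (hSmem s hs).1
        have hs0 : (0 : ℝ) < s := by exact_mod_cast hs1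
        have h1 := Hooley1963.sum_card_divisors_mul_sqrt_le (R / s)
        have h2 : ((R / s : ℕ) : ℝ) ≤ R / s := Nat.cast_div_le
        have h4 : (s : ℝ) * ((R / s : ℕ) : ℝ) ≤ R := by
          calc (s : ℝ) * ((R / s : ℕ) : ℝ) ≤ s * (R / s) := mul_le_mul_of_nonneg_left h2 hs0.le
            _ = R := by field_simp
        have h5 : Real.sqrt ((R / s : ℕ) : ℝ) ≤ Real.sqrt R :=
          Real.sqrt_le_sqrt (by exact_mod_cast Nat.div_le_self R s)
        have h6 := hlogdiv s hs
        have h7 : 0 ≤ 1 + Real.log ((R / s : ℕ) : ℝ) := by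
          rcases Nat.eq_zero_or_pos (R / s) with h0 | h0
          · rw [h0]; simp
          · have := Real.log_nonneg (show (1 : ℝ) ≤ ((R / s : ℕ) : ℝ) by exact_mod_cast h0); linarith
        have h3 : (s : ℝ) * (((R / s : ℕ) : ℝ) * Real.sqrt ((R / s : ℕ) : ℝ) * (1 + Real.log ((R / s : ℕ) : ℝ))) ≤
            (R : ℝ) * Real.sqrt R * (1 + Real.log R) := by
          calc (s : ℝ) * (((R / s : ℕ) : ℝ) * Real.sqrt ((R / s : ℕ) : ℝ) * (1 + Real.log ((R / s : ℕ) : ℝ)))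
              = ((s : ℝ) * ((R / s : ℕ) : ℝ)) * Real.sqrt ((R / s : ℕ) : ℝ) * (1 + Real.log ((R / s : ℕ) : ℝ)) := by ring
            _ ≤ (R : ℝ) * Real.sqrt R * (1 + Real.log R) :=
              mul_le_mul (mul_le_mul h4 h5 (Real.sqrt_nonneg _) hR0) h6 h7 (by positivity)
        exact (mul_le_mul_of_nonneg_left h1 hs0.le).trans h3
    _ = S.card * ((R : ℝ) * Real.sqrt R * (1 + Real.log R)) := by rw [Finset.sum_const, nsmul_eq_mul]

/-- The pointwise simplification of one slice bound (`r = r₁ r₂`, `b − a ≤ Λ`, `√|h| ≤ |h|`,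
`1/Q ≤ 1`, `log r₁ ≤ log R`). [folklore] -/
theorem sliceBound_le {Q : ℕ} (hQ : 0 < Q) {H Λ κ : ℝ} (hH : 1 ≤ H) (hΛ : 0 ≤ Λ) (hκ : 0 ≤ κ)
    {r R : ℕ} (hr : 1 ≤ r) (hrR : r ≤ R) {D : ℝ} (hD0 : 0 ≤ D) (hDΛ : D ≤ Λ) :
    ((Q : ℝ) * qPart Q r) *
        ((D / ((Q : ℝ) * qPart Q r) + 1) * H / (qFree Q r) +
          (Nat.divisors (qFree Q r)).card * Real.sqrt (qFree Q r) * Real.sqrt H *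
            (1 + Real.log (qFree Q r))) +
        D * (Real.pi * H * κ / ((Q : ℝ) * (r : ℝ) ^ 2)) ≤
      H * (Λ * ((qPart Q r : ℝ) / r) + Q * ((qPart Q r : ℝ) ^ 2 / r) +
        Q * (1 + Real.log R) * ((qPart Q r : ℝ) * ((Nat.divisors (qFree Q r)).card * Real.sqrt (qFree Q r))) +
        Real.pi * Λ * κ * (1 / (r : ℝ) ^ 2)) := by
  set LR : ℝ := 1 + Real.log R with hLR
  have hQ1 : (1 : ℝ) ≤ Q := by exact_mod_cast hQ
  have hr0 : (0 : ℝ) < r := by exact_mod_cast hr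
  have hr₁ := qFree_pos (Q := Q) hr
  have hr₂ := qPart_pos (Q := Q) hr
  have hr₁R : (0 : ℝ) < qFree Q r := by exact_mod_cast hr₁
  have hr₂R : (0 : ℝ) < qPart Q r := by exact_mod_cast hr₂
  have hrr : (r : ℝ) = (qFree Q r : ℝ) * qPart Q r := by exact_mod_cast (qFree_mul_qPart Q r).symm
  have hτ0 : (0 : ℝ) ≤ (Nat.divisors (qFree Q r)).card * Real.sqrt (qFree Q r) := by positivity
  have hlog1 : 1 + Real.log (qFree Q r) ≤ LR := by
    rw [hLR]
    have : (qFree Q r : ℝ) ≤ R := by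
      have h1 : qFree Q r ≤ r := Nat.div_le_self _ _
      exact_mod_cast h1.trans hrR
    linarith [Real.log_le_log hr₁R this]
  have hlog0 : 0 ≤ 1 + Real.log (qFree Q r) := by
    have := Real.log_nonneg (show (1 : ℝ) ≤ qFree Q r by exact_mod_cast hr₁); linarith
  have hsqH : Real.sqrt H ≤ H := by
    rw [Real.sqrt_le_left (by positivity)]; nlinarith
  have e1 : ((Q : ℝ) * qPart Q r) * ((D / ((Q : ℝ) * qPart Q r) + 1) * H / (qFree Q r)) =
      H * (D * ((qPart Q r : ℝ) / r)) + H * (Q * ((qPart Q r : ℝ) ^ 2 / r)) := by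
    rw [hrr]; field_simp
  have b1 : H * (D * ((qPart Q r : ℝ) / r)) ≤ H * (Λ * ((qPart Q r : ℝ) / r)) := by
    apply mul_le_mul_of_nonneg_left _ (by positivity)
    exact mul_le_mul_of_nonneg_right hDΛ (by positivity)
  have b2 : ((Q : ℝ) * qPart Q r) * ((Nat.divisors (qFree Q r)).card * Real.sqrt (qFree Q r) *
      Real.sqrt H * (1 + Real.log (qFree Q r))) ≤
      H * (Q * LR * ((qPart Q r : ℝ) * ((Nat.divisors (qFree Q r)).card * Real.sqrt (qFree Q r)))) := by
    have : (Nat.divisors (qFree Q r)).card * Real.sqrt (qFree Q r) * Real.sqrt H * (1 + Real.log (qFree Q r)) ≤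
        (Nat.divisors (qFree Q r)).card * Real.sqrt (qFree Q r) * H * LR :=
      mul_le_mul (mul_le_mul_of_nonneg_left hsqH hτ0) hlog1 hlog0 (by positivity)
    calc ((Q : ℝ) * qPart Q r) * ((Nat.divisors (qFree Q r)).card * Real.sqrt (qFree Q r) *
          Real.sqrt H * (1 + Real.log (qFree Q r)))
        ≤ ((Q : ℝ) * qPart Q r) * ((Nat.divisors (qFree Q r)).card * Real.sqrt (qFree Q r) * H * LR) :=
          mul_le_mul_of_nonneg_left this (by positivity)
      _ = _ := by ring
  have b3 : D * (Real.pi * H * κ / ((Q : ℝ) * (r : ℝ) ^ 2)) ≤ H * (Real.pi * Λ * κ * (1 / (r : ℝ) ^ 2)) := by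
    have hQr : Real.pi * H * κ / ((Q : ℝ) * (r : ℝ) ^ 2) ≤ Real.pi * H * κ / ((r : ℝ) ^ 2) := by
      apply div_le_div_of_nonneg_left (by positivity) (by positivity)
      calc (r : ℝ) ^ 2 = 1 * (r : ℝ) ^ 2 := (one_mul _).symm
        _ ≤ Q * (r : ℝ) ^ 2 := mul_le_mul_of_nonneg_right hQ1 (by positivity)
    calc D * (Real.pi * H * κ / ((Q : ℝ) * (r : ℝ) ^ 2))
        ≤ Λ * (Real.pi * H * κ / ((r : ℝ) ^ 2)) := mul_le_mul hDΛ hQr (by positivity) hΛ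
      _ = H * (Real.pi * Λ * κ * (1 / (r : ℝ) ^ 2)) := by ring
  rw [mul_add ((Q : ℝ) * qPart Q r), e1]
  linarith [b1, b2, b3]

/-- **L5a — the summation of the slice bounds over the moduli `r ≤ R ≤ c₁√N`** (blueprint §4):
`∑_{r ≤ R} [Q r₂ (((b−a)/(Q r₂) + 1)|h|/r₁ + τ(r₁)√r₁ √|h| (1 + log r₁)) + (b − a) π|h|κ/(Q r²)]
 ≤ C(c₁, c₂, κ) · Q^5 · |h| · N^{13/16} (1 + log N)²` (`r₁ r₂ = r`, Rankin for `#{r₂}`). [folklore] -/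
theorem exists_sum_sliceBound_le {c₁ c₂ κ : ℝ} (hc₁ : 0 ≤ c₁) (hc₂ : 0 ≤ c₂) (hκ : 0 ≤ κ) :
    ∃ C : ℝ, 0 ≤ C ∧ ∀ (Q : ℕ), 0 < Q → ∀ (h : ℤ), h ≠ 0 → ∀ (N R : ℕ) (a b : ℕ → ℤ), 1 ≤ N →
      (R : ℝ) ≤ c₁ * Real.sqrt N →
      (∀ r ∈ Icc 1 R, a r ≤ b r ∧ ((b r - a r : ℤ) : ℝ) ≤ c₂ * Real.sqrt N) →
      ∑ r ∈ Icc 1 R,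
        (((Q : ℝ) * qPart Q r) *
          ((((b r - a r : ℤ) : ℝ) / ((Q : ℝ) * qPart Q r) + 1) * |(h : ℝ)| / (qFree Q r) +
            (Nat.divisors (qFree Q r)).card * Real.sqrt (qFree Q r) * Real.sqrt |(h : ℝ)| *
              (1 + Real.log (qFree Q r))) +
          ((b r - a r : ℤ) : ℝ) * (Real.pi * |(h : ℝ)| * κ / ((Q : ℝ) * (r : ℝ) ^ 2))) ≤
        C * (Q : ℝ) ^ 5 * |(h : ℝ)| * ((N : ℝ) ^ (13 / 16 : ℝ) * (1 + Real.log N) ^ 2) := by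
  obtain ⟨L₁, hL₁⟩ : ∃ L₁ : ℝ, L₁ = 1 + max 0 (Real.log c₁) := ⟨_, rfl⟩
  have hL₁1 : 1 ≤ L₁ := by rw [hL₁]; have := le_max_left 0 (Real.log c₁); linarith
  have hL₁0 : 0 ≤ L₁ := by linarith
  -- the constant
  refine ⟨(c₂ * c₁ ^ (1 / 8 : ℝ) * L₁ + c₁ ^ (9 / 8 : ℝ) * L₁ + c₁ ^ (13 / 8 : ℝ) * L₁ * L₁ + 2 * Real.pi * c₂ * κ),
    by positivity, ?_⟩
  intro Q hQ h hh N R a b hN hR hab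
  have hN0 : (0 : ℝ) < N := by exact_mod_cast hN
  have hN1 : (1 : ℝ) ≤ N := by exact_mod_cast hN
  have hQ1 : (1 : ℝ) ≤ Q := by exact_mod_cast hQ
  have hh1 : (1 : ℝ) ≤ |(h : ℝ)| := by
    rw [← Int.cast_abs]; exact_mod_cast Int.one_le_abs hh
  obtain ⟨Λ, hΛ⟩ : ∃ Λ : ℝ, Λ = c₂ * Real.sqrt N := ⟨_, rfl⟩
  have hΛ0 : 0 ≤ Λ := by rw [hΛ]; positivity
  obtain ⟨H, hH⟩ : ∃ H : ℝ, H = |(h : ℝ)| := ⟨_, rfl⟩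
  rw [← hH] at hh1 ⊢
  have hH0 : 0 ≤ H := by linarith
  obtain ⟨S, hS⟩ : ∃ S : Finset ℕ, S = (Icc 1 R).filter (fun s => s ∣ Q ^ R) := ⟨_, rfl⟩
  obtain ⟨LR, hLR⟩ : ∃ LR : ℝ, LR = 1 + Real.log R := ⟨_, rfl⟩
  have hR0 : (0 : ℝ) ≤ R := Nat.cast_nonneg _
  have hLR0 : 0 ≤ LR := by
    rw [hLR]
    rcases Nat.eq_zero_or_pos R with h0 | h0
    · rw [h0]; simp
    · have := Real.log_nonneg (show (1 : ℝ) ≤ R by exact_mod_cast h0); linarith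
  -- Step 1: pointwise simplification of the summand
  have hpt : ∀ r ∈ Icc 1 R,
      ((Q : ℝ) * qPart Q r) *
          ((((b r - a r : ℤ) : ℝ) / ((Q : ℝ) * qPart Q r) + 1) * H / (qFree Q r) +
            (Nat.divisors (qFree Q r)).card * Real.sqrt (qFree Q r) * Real.sqrt H *
              (1 + Real.log (qFree Q r))) +
          ((b r - a r : ℤ) : ℝ) * (Real.pi * H * κ / ((Q : ℝ) * (r : ℝ) ^ 2)) ≤
        H * (Λ * ((qPart Q r : ℝ) / r) + Q * ((qPart Q r : ℝ) ^ 2 / r) +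
          Q * (1 + Real.log R) * ((qPart Q r : ℝ) * ((Nat.divisors (qFree Q r)).card * Real.sqrt (qFree Q r))) +
          Real.pi * Λ * κ * (1 / (r : ℝ) ^ 2)) := by
    intro r hr
    obtain ⟨hr1, hrR⟩ := Finset.mem_Icc.1 hr
    obtain ⟨hab1, hab2⟩ := hab r hr
    rw [← hΛ] at hab2
    exact sliceBound_le hQ hh1 hΛ0 hκ hr1 hrR (by exact_mod_cast sub_nonneg.2 hab1) hab2
  refine (Finset.sum_le_sum hpt).trans ?_
  rw [← Finset.mul_sum, Finset.sum_add_distrib, Finset.sum_add_distrib, Finset.sum_add_distrib,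
    ← Finset.mul_sum, ← Finset.mul_sum, ← Finset.mul_sum, ← Finset.mul_sum, ← hLR]
  -- Step 2: the four sums
  have hScard : (S.card : ℝ) ≤ (R : ℝ) ^ (1 / 8 : ℝ) * (Q : ℝ) ^ 4 := by rw [hS]; exact card_qSmooth_le hQ R
  have T1 : ∑ r ∈ Icc 1 R, (qPart Q r : ℝ) / r ≤ S.card * LR := by rw [hS, hLR]; exact sum_qPart_div_le Q R
  have T2 : ∑ r ∈ Icc 1 R, (qPart Q r : ℝ) ^ 2 / r ≤ R * (S.card * LR) := by
    rw [hS, hLR]; exact sum_qPart_sq_div_le Q R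
  have T3 : ∑ r ∈ Icc 1 R, (qPart Q r : ℝ) * ((Nat.divisors (qFree Q r)).card * Real.sqrt (qFree Q r)) ≤
      S.card * ((R : ℝ) * Real.sqrt R * LR) := by rw [hS, hLR]; exact sum_qPart_mul_divisors_sqrt_le Q R
  have T4 := Literature.NumberTheory.LFunctions.Green2012.sum_Icc_inv_sq_le_two R
  -- Step 3: sizes in terms of `N`
  have hS8 : (R : ℝ) ^ (1 / 8 : ℝ) ≤ c₁ ^ (1 / 8 : ℝ) * (N : ℝ) ^ (1 / 16 : ℝ) := by
    have := rpow_le_of_le_mul_sqrt hR0 hc₁ hN0.le hR (α := 1 / 8) (by norm_num)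
    convert this using 2; norm_num
  have hR138 : (R : ℝ) * Real.sqrt R * (R : ℝ) ^ (1 / 8 : ℝ) ≤ c₁ ^ (13 / 8 : ℝ) * (N : ℝ) ^ (13 / 16 : ℝ) := by
    have := rpow_le_of_le_mul_sqrt hR0 hc₁ hN0.le hR (α := 13 / 8) (by norm_num)
    have e : (R : ℝ) * Real.sqrt R * (R : ℝ) ^ (1 / 8 : ℝ) = (R : ℝ) ^ (13 / 8 : ℝ) := by
      rw [show (13 / 8 : ℝ) = (1 + 1 / 2) + 1 / 8 by norm_num, Real.rpow_add' hR0 (by norm_num),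
        Real.rpow_add' hR0 (by norm_num), Real.rpow_one, Real.sqrt_eq_rpow]
    rw [e]; convert this using 2; norm_num
  have hN16 : ∀ β : ℝ, β ≤ 13 / 16 → (N : ℝ) ^ β ≤ (N : ℝ) ^ (13 / 16 : ℝ) := fun β hβ =>
    Real.rpow_le_rpow_of_exponent_le hN1 hβ
  have hsqrtN : Real.sqrt N * (N : ℝ) ^ (1 / 16 : ℝ) ≤ (N : ℝ) ^ (13 / 16 : ℝ) := by
    rw [Real.sqrt_eq_rpow, ← Real.rpow_add hN0]
    exact hN16 _ (by norm_num)
  have hRN : (R : ℝ) * (N : ℝ) ^ (1 / 16 : ℝ) ≤ c₁ * (N : ℝ) ^ (13 / 16 : ℝ) := by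
    calc (R : ℝ) * (N : ℝ) ^ (1 / 16 : ℝ) ≤ (c₁ * Real.sqrt N) * (N : ℝ) ^ (1 / 16 : ℝ) :=
          mul_le_mul_of_nonneg_right hR (by positivity)
      _ = c₁ * (Real.sqrt N * (N : ℝ) ^ (1 / 16 : ℝ)) := by ring
      _ ≤ c₁ * (N : ℝ) ^ (13 / 16 : ℝ) := mul_le_mul_of_nonneg_left hsqrtN hc₁
  have hlogN0 : 0 ≤ Real.log N := Real.log_nonneg hN1
  have hlogN1 : 1 ≤ 1 + Real.log N := by linarith
  have hlogsq : 1 + Real.log N ≤ (1 + Real.log N) ^ 2 := by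
    have : 0 ≤ (1 + Real.log N) * Real.log N := mul_nonneg (by linarith) hlogN0
    nlinarith
  have hLRL : LR ≤ L₁ * (1 + Real.log N) := by
    rw [hLR]
    rcases Nat.eq_zero_or_pos R with h0 | h0
    · rw [h0]; simp
      have := mul_le_mul hL₁1 hlogN1 zero_le_one hL₁0
      linarith
    · have hR1 : (0 : ℝ) < R := by exact_mod_cast h0
      have hc₁0 : 0 < c₁ := by
        by_contra hle
        have : c₁ = 0 := le_antisymm (not_lt.1 hle) hc₁
        rw [this, zero_mul] at hR; linarith
      have h1 : Real.log R ≤ Real.log (c₁ * Real.sqrt N) := Real.log_le_log hR1 hR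
      rw [Real.log_mul hc₁0.ne' (by positivity), Real.log_sqrt hN0.le] at h1
      have h2 : Real.log c₁ ≤ max 0 (Real.log c₁) := le_max_right _ _
      have h3 : 1 + Real.log R ≤ L₁ + Real.log N := by rw [hL₁]; linarith
      have h4 := mul_le_mul_of_nonneg_right hL₁1 hlogN0
      linarith
  -- Step 4: assemble; `Y = N^{13/16} (1 + log N)²`, `P5 = Q^5`
  have hY0 : 0 ≤ (N : ℝ) ^ (13 / 16 : ℝ) * (1 + Real.log N) ^ 2 := by positivity
  have hQ45 : (Q : ℝ) ^ 4 ≤ (Q : ℝ) ^ 5 := pow_le_pow_right₀ hQ1 (by norm_num)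
  have hQ5' : (Q : ℝ) * (Q : ℝ) ^ 4 = (Q : ℝ) ^ 5 := by ring
  have hQ50 : (0 : ℝ) ≤ (Q : ℝ) ^ 5 := by positivity
  have hSL : (S.card : ℝ) * LR ≤ (c₁ ^ (1 / 8 : ℝ) * L₁) * ((Q : ℝ) ^ 4 * ((N : ℝ) ^ (1 / 16 : ℝ) * (1 + Real.log N))) := by
    calc (S.card : ℝ) * LR ≤ ((R : ℝ) ^ (1 / 8 : ℝ) * (Q : ℝ) ^ 4) * (L₁ * (1 + Real.log N)) :=
          mul_le_mul hScard hLRL hLR0 (by positivity)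
      _ ≤ (c₁ ^ (1 / 8 : ℝ) * (N : ℝ) ^ (1 / 16 : ℝ) * (Q : ℝ) ^ 4) * (L₁ * (1 + Real.log N)) := by
          apply mul_le_mul_of_nonneg_right _ (by positivity)
          exact mul_le_mul_of_nonneg_right hS8 (by positivity)
      _ = _ := by ring
  have A1 : Λ * ∑ r ∈ Icc 1 R, (qPart Q r : ℝ) / r ≤
      (c₂ * c₁ ^ (1 / 8 : ℝ) * L₁) * ((Q : ℝ) ^ 5 * ((N : ℝ) ^ (13 / 16 : ℝ) * (1 + Real.log N) ^ 2)) := by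
    have h1 : Λ * ∑ r ∈ Icc 1 R, (qPart Q r : ℝ) / r ≤
        Λ * ((c₁ ^ (1 / 8 : ℝ) * L₁) * ((Q : ℝ) ^ 4 * ((N : ℝ) ^ (1 / 16 : ℝ) * (1 + Real.log N)))) :=
      mul_le_mul_of_nonneg_left (T1.trans hSL) hΛ0
    have h2 : Λ * ((c₁ ^ (1 / 8 : ℝ) * L₁) * ((Q : ℝ) ^ 4 * ((N : ℝ) ^ (1 / 16 : ℝ) * (1 + Real.log N)))) =
        (c₂ * c₁ ^ (1 / 8 : ℝ) * L₁) * ((Q : ℝ) ^ 4 * ((Real.sqrt N * (N : ℝ) ^ (1 / 16 : ℝ)) * (1 + Real.log N))) := by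
      rw [hΛ]; ring
    have h3 : (Q : ℝ) ^ 4 * ((Real.sqrt N * (N : ℝ) ^ (1 / 16 : ℝ)) * (1 + Real.log N)) ≤
        (Q : ℝ) ^ 5 * ((N : ℝ) ^ (13 / 16 : ℝ) * (1 + Real.log N) ^ 2) := by
      refine mul_le_mul hQ45 ?_ (by positivity) hQ50
      exact mul_le_mul hsqrtN hlogsq (by positivity) (by positivity)
    rw [h2] at h1
    exact h1.trans (mul_le_mul_of_nonneg_left h3 (by positivity))
  have A2 : (Q : ℝ) * ∑ r ∈ Icc 1 R, (qPart Q r : ℝ) ^ 2 / r ≤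
      (c₁ ^ (9 / 8 : ℝ) * L₁) * ((Q : ℝ) ^ 5 * ((N : ℝ) ^ (13 / 16 : ℝ) * (1 + Real.log N) ^ 2)) := by
    have h1 : (Q : ℝ) * ∑ r ∈ Icc 1 R, (qPart Q r : ℝ) ^ 2 / r ≤
        Q * (R * ((c₁ ^ (1 / 8 : ℝ) * L₁) * ((Q : ℝ) ^ 4 * ((N : ℝ) ^ (1 / 16 : ℝ) * (1 + Real.log N))))) :=
      mul_le_mul_of_nonneg_left (T2.trans (mul_le_mul_of_nonneg_left hSL hR0)) (by positivity)
    have h2 : (Q : ℝ) * (R * ((c₁ ^ (1 / 8 : ℝ) * L₁) * ((Q : ℝ) ^ 4 * ((N : ℝ) ^ (1 / 16 : ℝ) * (1 + Real.log N))))) =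
        (c₁ ^ (1 / 8 : ℝ) * L₁) * ((Q : ℝ) ^ 5 * (((R : ℝ) * (N : ℝ) ^ (1 / 16 : ℝ)) * (1 + Real.log N))) := by ring
    have h3 : (R : ℝ) * (N : ℝ) ^ (1 / 16 : ℝ) * (1 + Real.log N) ≤ (c₁ * (N : ℝ) ^ (13 / 16 : ℝ)) * (1 + Real.log N) ^ 2 :=
      mul_le_mul hRN hlogsq (by positivity) (by positivity)
    have h4 : c₁ ^ (1 / 8 : ℝ) * c₁ = c₁ ^ (9 / 8 : ℝ) := by
      rw [show (9 / 8 : ℝ) = 1 / 8 + 1 by norm_num, Real.rpow_add' hc₁ (by norm_num), Real.rpow_one]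
    rw [h2] at h1
    calc (Q : ℝ) * ∑ r ∈ Icc 1 R, (qPart Q r : ℝ) ^ 2 / r
        ≤ (c₁ ^ (1 / 8 : ℝ) * L₁) * ((Q : ℝ) ^ 5 * (((R : ℝ) * (N : ℝ) ^ (1 / 16 : ℝ)) * (1 + Real.log N))) := h1
      _ ≤ (c₁ ^ (1 / 8 : ℝ) * L₁) * ((Q : ℝ) ^ 5 * ((c₁ * (N : ℝ) ^ (13 / 16 : ℝ)) * (1 + Real.log N) ^ 2)) :=
          mul_le_mul_of_nonneg_left (mul_le_mul_of_nonneg_left h3 hQ50) (by positivity)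
      _ = (c₁ ^ (1 / 8 : ℝ) * c₁) * L₁ * ((Q : ℝ) ^ 5 * ((N : ℝ) ^ (13 / 16 : ℝ) * (1 + Real.log N) ^ 2)) := by ring
      _ = (c₁ ^ (9 / 8 : ℝ) * L₁) * ((Q : ℝ) ^ 5 * ((N : ℝ) ^ (13 / 16 : ℝ) * (1 + Real.log N) ^ 2)) := by rw [h4]
  have A3 : (Q : ℝ) * LR * ∑ r ∈ Icc 1 R, (qPart Q r : ℝ) * ((Nat.divisors (qFree Q r)).card * Real.sqrt (qFree Q r)) ≤
      (c₁ ^ (13 / 8 : ℝ) * L₁ * L₁) * ((Q : ℝ) ^ 5 * ((N : ℝ) ^ (13 / 16 : ℝ) * (1 + Real.log N) ^ 2)) := by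
    have h1 : (Q : ℝ) * LR * ∑ r ∈ Icc 1 R, (qPart Q r : ℝ) * ((Nat.divisors (qFree Q r)).card * Real.sqrt (qFree Q r)) ≤
        (Q * (L₁ * (1 + Real.log N))) * (((R : ℝ) ^ (1 / 8 : ℝ) * (Q : ℝ) ^ 4) * ((R : ℝ) * Real.sqrt R * (L₁ * (1 + Real.log N)))) := by
      refine mul_le_mul (mul_le_mul_of_nonneg_left hLRL (by positivity)) (T3.trans ?_) ?_ (by positivity)
      · exact mul_le_mul hScard (mul_le_mul_of_nonneg_left hLRL (by positivity)) (by positivity) (by positivity)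
      · exact Finset.sum_nonneg fun r _ => by positivity
    have h2 : (Q * (L₁ * (1 + Real.log N))) * (((R : ℝ) ^ (1 / 8 : ℝ) * (Q : ℝ) ^ 4) * ((R : ℝ) * Real.sqrt R * (L₁ * (1 + Real.log N)))) =
        (L₁ * L₁) * ((Q : ℝ) ^ 5 * (((R : ℝ) * Real.sqrt R * (R : ℝ) ^ (1 / 8 : ℝ)) * (1 + Real.log N) ^ 2)) := by ring
    rw [h2] at h1
    calc _ ≤ (L₁ * L₁) * ((Q : ℝ) ^ 5 * (((R : ℝ) * Real.sqrt R * (R : ℝ) ^ (1 / 8 : ℝ)) * (1 + Real.log N) ^ 2)) := h1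
      _ ≤ (L₁ * L₁) * ((Q : ℝ) ^ 5 * ((c₁ ^ (13 / 8 : ℝ) * (N : ℝ) ^ (13 / 16 : ℝ)) * (1 + Real.log N) ^ 2)) := by
          apply mul_le_mul_of_nonneg_left _ (by positivity)
          apply mul_le_mul_of_nonneg_left _ hQ50
          exact mul_le_mul_of_nonneg_right hR138 (by positivity)
      _ = (c₁ ^ (13 / 8 : ℝ) * L₁ * L₁) * ((Q : ℝ) ^ 5 * ((N : ℝ) ^ (13 / 16 : ℝ) * (1 + Real.log N) ^ 2)) := by ring
  have A4 : Real.pi * Λ * κ * ∑ r ∈ Icc 1 R, 1 / (r : ℝ) ^ 2 ≤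
      (2 * Real.pi * c₂ * κ) * ((Q : ℝ) ^ 5 * ((N : ℝ) ^ (13 / 16 : ℝ) * (1 + Real.log N) ^ 2)) := by
    have h1 : Real.pi * Λ * κ * ∑ r ∈ Icc 1 R, 1 / (r : ℝ) ^ 2 ≤ Real.pi * Λ * κ * 2 :=
      mul_le_mul_of_nonneg_left T4 (by positivity)
    have h2 : Real.pi * Λ * κ * 2 = (2 * Real.pi * c₂ * κ) * Real.sqrt N := by rw [hΛ]; ring
    have h3 : Real.sqrt N ≤ (Q : ℝ) ^ 5 * ((N : ℝ) ^ (13 / 16 : ℝ) * (1 + Real.log N) ^ 2) := by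
      have e1 : Real.sqrt N ≤ (N : ℝ) ^ (13 / 16 : ℝ) := by rw [Real.sqrt_eq_rpow]; exact hN16 _ (by norm_num)
      have e2 : (1 : ℝ) ≤ (Q : ℝ) ^ 5 := one_le_pow₀ hQ1
      have e3 : (1 : ℝ) ≤ (1 + Real.log N) ^ 2 := one_le_pow₀ hlogN1
      calc Real.sqrt N ≤ (N : ℝ) ^ (13 / 16 : ℝ) := e1
        _ = 1 * ((N : ℝ) ^ (13 / 16 : ℝ) * 1) := by ring
        _ ≤ (Q : ℝ) ^ 5 * ((N : ℝ) ^ (13 / 16 : ℝ) * (1 + Real.log N) ^ 2) :=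
            mul_le_mul e2 (mul_le_mul_of_nonneg_left e3 (by positivity)) (by positivity) hQ50
    rw [h2] at h1
    exact h1.trans (mul_le_mul_of_nonneg_left h3 (by positivity))
  have key : Λ * ∑ r ∈ Icc 1 R, (qPart Q r : ℝ) / r + Q * ∑ r ∈ Icc 1 R, (qPart Q r : ℝ) ^ 2 / r +
        Q * LR * ∑ r ∈ Icc 1 R, (qPart Q r : ℝ) * ((Nat.divisors (qFree Q r)).card * Real.sqrt (qFree Q r)) +
        Real.pi * Λ * κ * ∑ r ∈ Icc 1 R, 1 / (r : ℝ) ^ 2 ≤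
      (c₂ * c₁ ^ (1 / 8 : ℝ) * L₁ + c₁ ^ (9 / 8 : ℝ) * L₁ + c₁ ^ (13 / 8 : ℝ) * L₁ * L₁ + 2 * Real.pi * c₂ * κ) *
        ((Q : ℝ) ^ 5 * ((N : ℝ) ^ (13 / 16 : ℝ) * (1 + Real.log N) ^ 2)) := by
    have := add_le_add (add_le_add (add_le_add A1 A2) A3) A4
    calc _ ≤ _ := this
      _ = _ := by ring
  calc H * (Λ * ∑ r ∈ Icc 1 R, (qPart Q r : ℝ) / r + Q * ∑ r ∈ Icc 1 R, (qPart Q r : ℝ) ^ 2 / r +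
        Q * LR * ∑ r ∈ Icc 1 R, (qPart Q r : ℝ) * ((Nat.divisors (qFree Q r)).card * Real.sqrt (qFree Q r)) +
        Real.pi * Λ * κ * ∑ r ∈ Icc 1 R, 1 / (r : ℝ) ^ 2)
      ≤ H * ((c₂ * c₁ ^ (1 / 8 : ℝ) * L₁ + c₁ ^ (9 / 8 : ℝ) * L₁ + c₁ ^ (13 / 8 : ℝ) * L₁ * L₁ + 2 * Real.pi * c₂ * κ) *
        ((Q : ℝ) ^ 5 * ((N : ℝ) ^ (13 / 16 : ℝ) * (1 + Real.log N) ^ 2))) := mul_le_mul_of_nonneg_left key hH0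
    _ = _ := by ring

/-- `‖e(t) − 1‖ ≤ 2π|t|` for real `t`. [folklore] -/
theorem norm_e_sub_one_le (t : ℝ) : ‖e (t : ℂ) - 1‖ ≤ 2 * Real.pi * |t| := by
  unfold e
  rw [show 2 * Real.pi * Complex.I * (t : ℂ) = Complex.I * ((2 * Real.pi * t : ℝ) : ℂ) by push_cast; ring,
    Complex.norm_exp_I_mul_ofReal_sub_one]
  have h1 := Real.abs_sin_le_abs (x := 2 * Real.pi * t / 2)
  rw [Real.norm_eq_abs, abs_mul, abs_two]
  calc 2 * |Real.sin (2 * Real.pi * t / 2)| ≤ 2 * |2 * Real.pi * t / 2| := by linarith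
    _ = 2 * Real.pi * |t| := by
        rw [abs_div, abs_mul, abs_mul, abs_of_pos Real.pi_pos, abs_two]; ring

/-- **The small twist is small**: if `|(2Ap + Br)| r ≤ κ P(p, r)` and `P(p, r) > 0`, then
`‖tw − 1‖ ≤ π |h| κ/(Q r²)`. [folklore] -/
theorem norm_tw_sub_one_le {P : BinQF} {r : ℕ} (hr : 1 ≤ r) {Q : ℕ} (hQ : 0 < Q) (h : ℤ) {p : ℤ}
    (hn : 0 < P.eval p r) {κ : ℝ}
    (harg : |((2 * P.a * p + P.b * r : ℤ) : ℝ)| * r ≤ κ * (P.eval p r : ℝ)) :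
    ‖tw P r Q h p - 1‖ ≤ Real.pi * |(h : ℝ)| * κ / ((Q : ℝ) * (r : ℝ) ^ 2) := by
  have hr0 : (0 : ℝ) < r := by exact_mod_cast hr
  have hQ0 : (0 : ℝ) < Q := by exact_mod_cast hQ
  have hn0 : (0 : ℝ) < (P.eval p r : ℝ) := by exact_mod_cast hn
  set L : ℝ := ((2 * P.a * p + P.b * r : ℤ) : ℝ) with hL
  have hκ0 : 0 ≤ κ := by
    have : 0 ≤ |L| * r := by positivity
    nlinarith
  rw [tw, show (-((h : ℂ) * ((2 * P.a * p + P.b * (r : ℕ) : ℤ) : ℂ)) / (2 * (Q : ℂ) * ((r : ℕ) : ℤ) * (P.eval p r : ℂ))) =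
    ((-((h : ℝ) * L) / (2 * (Q : ℝ) * r * (P.eval p r : ℝ)) : ℝ) : ℂ) by rw [hL]; push_cast; ring]
  refine (norm_e_sub_one_le _).trans ?_
  rw [abs_div, abs_neg, abs_mul, show |(2 : ℝ) * Q * r * (P.eval p r : ℝ)| = 2 * Q * r * (P.eval p r : ℝ) from
    abs_of_pos (by positivity)]
  rw [show 2 * Real.pi * (|(h : ℝ)| * |L| / (2 * Q * r * (P.eval p r : ℝ))) =
    (Real.pi * |(h : ℝ)|) * (|L| / (Q * r * (P.eval p r : ℝ))) by field_simp,
    show Real.pi * |(h : ℝ)| * κ / ((Q : ℝ) * (r : ℝ) ^ 2) = (Real.pi * |(h : ℝ)|) * (κ / (Q * (r : ℝ) ^ 2)) by ring]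
  refine mul_le_mul_of_nonneg_left ?_ (by positivity)
  rw [div_le_div_iff₀ (by positivity) (by positivity)]
  calc |L| * (Q * (r : ℝ) ^ 2) = Q * r * (|L| * r) := by ring
    _ ≤ Q * r * (κ * (P.eval p r : ℝ)) := mul_le_mul_of_nonneg_left harg (by positivity)
    _ = κ * (Q * r * (P.eval p r : ℝ)) := by ring

/-- **L5 — the class bound, explicit and uniform in `Q, u₀, h`** (blueprint §4–§5).  For a form
`P` with `A > 0`, even `B`, non-square discriminant, slice data `d` (the tree's, at any `h₀`: only its
geometric fields are used) and an EXPONENT bound `|(2Ap + Br)| r ≤ κ P(p, r)` on the slices, there is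
`C ≥ 0` with, for all `Q ≥ 1`, `u₀`, `h ≠ 0`, `N ≥ 1` and `S` = the `T`-reduced forms of the class with
`0 < A_R ≤ N`: `‖∑_{R ∈ S} W(R)‖ ≤ 1 + C Q^5 |h| N^{13/16} (1 + log N)²`. [folklore] -/
theorem exists_norm_class_sum_le {P : BinQF} {h₀ : ℤ} (d : Hooley1963.SliceData P h₀) (hA : 0 < P.a)
    (hΔ : ¬ IsSquare P.disc) (hB : Even P.b) {κ : ℝ} (hκ : 0 ≤ κ)
    (harg : ∀ N : ℕ, 1 ≤ N → ∀ r ∈ Icc 1 (d.R N), ∀ p ∈ Finset.Ioo (d.a N r) (d.b N r),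
      |((2 * P.a * p + P.b * r : ℤ) : ℝ)| * r ≤ κ * (P.eval p r : ℝ)) :
    ∃ C : ℝ, 0 ≤ C ∧ ∀ (Q : ℕ), 0 < Q → ∀ (u₀ : ℕ) (h : ℤ), h ≠ 0 → ∀ N : ℕ, 1 ≤ N →
      ∀ S : Finset BinQF,
        (∀ R, R ∈ S ↔ (∃ ξ : SL(2, ℤ), R = smul P ξ) ∧ IsTReduced R ∧ 0 < R.a ∧ R.a ≤ N) →
        ‖∑ R ∈ S, Wf Q u₀ h R‖ ≤
          1 + C * (Q : ℝ) ^ 5 * |(h : ℝ)| * ((N : ℝ) ^ (13 / 16 : ℝ) * (1 + Real.log N) ^ 2) := by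
  obtain ⟨C, hC0, hC⟩ := exists_sum_sliceBound_le d.hc₁ d.hc₂ hκ
  refine ⟨C, hC0, fun Q hQ u₀ h hh N hN S hS => ?_⟩
  have hmul := d.sum_vecSet_eq hA hΔ hN hS (Wf Q u₀ h)
  rw [d.sum_vecSet_eq_sum_slices N] at hmul
  -- rewrite every slice through `Wf_vecForm` and bound it by `norm_slice_le`
  have hslice : ∀ r ∈ Icc 1 (d.R N),
      ‖∑ p ∈ (Finset.Ioo (d.a N r) (d.b N r)).filter (fun p : ℤ => Int.gcd p r = 1),
          Wf Q u₀ h (vecForm P (p, (r : ℤ)))‖ ≤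
        ((Q : ℝ) * qPart Q r) *
          ((((d.b N r - d.a N r : ℤ) : ℝ) / ((Q : ℝ) * qPart Q r) + 1) * |(h : ℝ)| / (qFree Q r) +
            (Nat.divisors (qFree Q r)).card * Real.sqrt (qFree Q r) * Real.sqrt |(h : ℝ)| *
              (1 + Real.log (qFree Q r))) +
          ((d.b N r - d.a N r : ℤ) : ℝ) * (Real.pi * |(h : ℝ)| * κ / ((Q : ℝ) * (r : ℝ) ^ 2)) := by
    intro r hr
    obtain ⟨hr1, hrR⟩ := Finset.mem_Icc.1 hr
    have hsum : ∑ p ∈ (Finset.Ioo (d.a N r) (d.b N r)).filter (fun p : ℤ => Int.gcd p r = 1),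
        Wf Q u₀ h (vecForm P (p, (r : ℤ))) =
        ∑ p ∈ (Finset.Ioo (d.a N r) (d.b N r)).filter (fun p : ℤ => Int.gcd p r = 1),
          clsInd P r Q u₀ p * twW P r Q h p :=
      Finset.sum_congr rfl fun p hp => Wf_vecForm P Q u₀ h (Finset.mem_filter.1 hp).2
    rw [hsum]
    have hpos : ∀ p ∈ Finset.Ioo (d.a N r) (d.b N r), 0 < P.eval p r := by
      intro p hp
      obtain ⟨hap, hpb⟩ := Finset.mem_Ioo.1 hp
      exact ((d.slice N hN r hr1 p).2 ⟨hrR, hap, hpb⟩).2.1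
    refine norm_slice_le hB hr1 hQ u₀ hh (d.a N r) (d.b N r) (d.ab_le N hN r hr).1 (by positivity) hpos ?_
    intro p hp
    exact norm_tw_sub_one_le hr1 hQ h (hpos p hp) (harg N hN r hr p hp)
  have hmain : ‖∑ r ∈ Icc 1 (d.R N),
      ∑ p ∈ (Finset.Ioo (d.a N r) (d.b N r)).filter (fun p : ℤ => Int.gcd p r = 1),
        Wf Q u₀ h (vecForm P (p, (r : ℤ)))‖ ≤
      C * (Q : ℝ) ^ 5 * |(h : ℝ)| * ((N : ℝ) ^ (13 / 16 : ℝ) * (1 + Real.log N) ^ 2) := by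
    refine (norm_sum_le _ _).trans ((Finset.sum_le_sum hslice).trans ?_)
    exact hC Q hQ h hh N (d.R N) (d.a N) (d.b N) hN (d.R_le N hN) (d.ab_le N hN)
  have haxis : ‖(if P.a ≤ N then Wf Q u₀ h (vecForm P (1, 0)) else 0)‖ ≤ 1 := by
    split_ifs
    · exact norm_Wf_le _ _ _ _
    · simp
  have hmΦ : ‖(d.mult : ℂ) * ∑ R ∈ S, Wf Q u₀ h R‖ ≤
      1 + C * (Q : ℝ) ^ 5 * |(h : ℝ)| * ((N : ℝ) ^ (13 / 16 : ℝ) * (1 + Real.log N) ^ 2) := by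
    rw [← hmul]
    exact (norm_add_le _ _).trans (add_le_add haxis hmain)
  have hm1 : (1 : ℝ) ≤ d.mult := by exact_mod_cast d.one_le_mult hA
  rw [norm_mul, Complex.norm_natCast] at hmΦ
  have h0 : 0 ≤ ‖∑ R ∈ S, Wf Q u₀ h R‖ := norm_nonneg _
  nlinarith

/-! ### L7 — assembly -/

/-- **L7a — the dilated Weyl sum through the roots of `X² − D`**: for `m ≥ 1` prime to `Q`,
`S_{Q²X²−D}(h, m) = ∑_{ν mod m, ν² ≡ D} e(hν/(Qm)) e(−h m̄ ν/Q)` (L1 with `Q e ≡ 1 (mod m)`, then L2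
with `μ = e ν`, `Q μ = ν + ((Qe − 1)ν/m) m`). [folklore] -/
theorem dilateWeylSum_eq_sum_roots {m Q : ℕ} (hm : 0 < m) (hQ : 0 < Q) (hmQ : m.Coprime Q) (D h : ℤ) :
    polyRootWeylSum (C ((Q : ℤ) ^ 2) * X ^ 2 - C D) m h =
      ∑ ν ∈ (Finset.range m).filter (fun ν : ℕ => (m : ℤ) ∣ (ν : ℤ) ^ 2 - D),
        e ((h : ℂ) * (ν : ℂ) / ((Q : ℂ) * m)) * e (-((h : ℂ) * mbarOf Q m * (ν : ℂ)) / Q) := by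
  -- an integer inverse `e₀` of `Q` modulo `m`
  obtain ⟨e₀, he₀⟩ : ∃ e₀ : ℤ, (Q : ℤ) * e₀ ≡ 1 [ZMOD m] := by
    haveI : NeZero m := ⟨hm.ne'⟩
    have hu : IsUnit ((Q : ℕ) : ZMod m) := (ZMod.isUnit_iff_coprime _ _).2 hmQ.symm
    refine ⟨(((Q : ZMod m))⁻¹.val : ℤ), ?_⟩
    rw [← ZMod.intCast_eq_intCast_iff]; push_cast
    rw [ZMod.natCast_zmod_val]; exact ZMod.mul_inv_of_unit _ hu
  rw [polyRootWeylSum_dilate hmQ D he₀ h, polyRootWeylSum]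
  have hpoly : ∀ ν : ℕ, ((m : ℤ) ∣ (X ^ 2 - C D : ℤ[X]).eval (ν : ℤ)) ↔ ((m : ℤ) ∣ (ν : ℤ) ^ 2 - D) := by
    intro ν; simp
  rw [Finset.filter_congr (fun ν _ => hpoly ν)]
  refine Finset.sum_congr rfl fun ν hν => ?_
  obtain ⟨hνm, -⟩ := Finset.mem_filter.1 hν
  -- `Q (e₀ ν) = ν + j m`
  obtain ⟨c, hc⟩ := Int.modEq_iff_dvd.1 he₀.symm
  have hμ : (Q : ℤ) * (e₀ * ν) = ν + (c * ν) * m := by linear_combination (ν : ℤ) * hc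
  have hmbar : (m : ℤ) * mbarOf Q m ≡ 1 [ZMOD Q] := by
    have := mul_mbarOf_modEq hQ (n := (m : ℤ)) (by
      rw [Int.gcd_natCast_natCast]; exact Nat.coprime_iff_gcd_eq_one.1 hmQ)
    simpa using this
  have := e_dilatedRoot_eq hm hQ hμ hmbar h
  rw [show Complex.exp (2 * Real.pi * Complex.I * ((h * e₀ : ℤ) * (ν : ℂ) / (m : ℂ) : ℂ)) =
      e ((h : ℂ) * ((e₀ * ν : ℤ) : ℂ) / m) by rw [e]; push_cast; ring_nf, this]
  push_cast; ring_nf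

/-- The class indicator on naturals agrees with the one on `A_R`. [folklore] -/
theorem ind_nat_iff_ind_int (Q u₀ : ℕ) (m : ℕ) :
    (m ≡ u₀ [MOD Q] ∧ m.Coprime Q) ↔ (((m : ℤ)) ≡ u₀ [ZMOD Q] ∧ Int.gcd (m : ℤ) Q = 1) := by
  rw [Int.natCast_modEq_iff, Int.gcd_natCast_natCast, Nat.coprime_iff_gcd_eq_one]

/-- The summand on roots: `F(m, ν) = 1[m ≡ u₀ (Q), (m,Q)=1] · e(hν/(Qm)) · e(−h m̄ ν/Q)`. [folklore] -/
def Froot (Q u₀ : ℕ) (h : ℤ) (m : ℕ) (ν : ℤ) : ℂ :=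
  (if ((m : ℤ) ≡ u₀ [ZMOD Q] ∧ Int.gcd (m : ℤ) Q = 1) then (1 : ℂ) else 0) *
    (e ((h : ℂ) * (ν : ℂ) / ((Q : ℂ) * m)) * e (-((h : ℂ) * mbarOf Q m * (ν : ℂ)) / Q))

/-- `F(m, ν + m t) = F(m, ν)`: for `(m, Q) = 1` the two phases change by `e(ht/Q)` and
`e(−h m̄ m t/Q)`, whose product is `e(htℓ)`, `Qℓ = 1 − m̄ m`. [folklore] -/
theorem Froot_periodic {Q : ℕ} (hQ : 0 < Q) (u₀ : ℕ) (h : ℤ) (m : ℕ) (ν t : ℤ) :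
    Froot Q u₀ h m (ν + m * t) = Froot Q u₀ h m ν := by
  unfold Froot
  split_ifs with hc
  · rcases Nat.eq_zero_or_pos m with hm0 | hm
    · subst hm0; simp
    obtain ⟨ℓ, hℓ⟩ : (Q : ℤ) ∣ 1 - mbarOf Q m * m := by
      have := Int.modEq_iff_dvd.1 (mul_mbarOf_modEq hQ hc.2)
      simpa [mul_comm] using this
    have hmC : (m : ℂ) ≠ 0 := by exact_mod_cast hm.ne'
    have hQC : (Q : ℂ) ≠ 0 := by exact_mod_cast hQ.ne'
    have hℓC : (1 : ℂ) - (mbarOf Q m : ℂ) * m = Q * ℓ := by exact_mod_cast hℓ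
    congr 1
    rw [← e_add, ← e_add]
    have : (h : ℂ) * ((ν + m * t : ℤ) : ℂ) / ((Q : ℂ) * m) + -((h : ℂ) * mbarOf Q m * ((ν + m * t : ℤ) : ℂ)) / Q =
        ((h : ℂ) * (ν : ℂ) / ((Q : ℂ) * m) + -((h : ℂ) * mbarOf Q m * (ν : ℂ)) / Q) + ((h * t * ℓ : ℤ) : ℂ) := by
      push_cast
      field_simp
      linear_combination (h : ℂ) * t * m * hℓC
    rw [this, e_add_intCast]
  · simp

/-- **L7b — the class-filtered dilated Weyl sums as a sum of `W` over the `T`-reduced forms of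
discriminant `4D`.** [folklore] -/
theorem sum_filter_dilate_eq_sum_levelForms {Q : ℕ} (hQ : 0 < Q) (u₀ : ℕ) (D h : ℤ) (M : ℕ) :
    ∑ m ∈ (Icc 1 M).filter (fun m : ℕ => m ≡ u₀ [MOD Q] ∧ m.Coprime Q),
        polyRootWeylSum (C ((Q : ℤ) ^ 2) * X ^ 2 - C D) m h =
      ∑ R ∈ levelFormsUpTo 1 0 (-D) 1 M, Wf Q u₀ h R := by
  -- Step 1: through the roots of `X² − D`
  have h1 : ∑ m ∈ (Icc 1 M).filter (fun m : ℕ => m ≡ u₀ [MOD Q] ∧ m.Coprime Q),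
        polyRootWeylSum (C ((Q : ℤ) ^ 2) * X ^ 2 - C D) m h =
      ∑ m ∈ Icc 1 M, ∑ ν ∈ (Finset.range m).filter (fun ν : ℕ => (m : ℤ) ∣ (ν : ℤ) ^ 2 - D),
        Froot Q u₀ h m ν := by
    rw [Finset.sum_filter]
    refine Finset.sum_congr rfl fun m hm => ?_
    have hm1 : 0 < m := (Finset.mem_Icc.1 hm).1
    split_ifs with hc
    · rw [dilateWeylSum_eq_sum_roots hm1 hQ hc.2 D h]
      refine Finset.sum_congr rfl fun ν _ => ?_
      rw [Froot, if_pos ((ind_nat_iff_ind_int Q u₀ m).1 hc), one_mul]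
      push_cast; ring_nf
    · symm
      refine Finset.sum_eq_zero fun ν _ => ?_
      rw [Froot, if_neg (fun hc' => hc ((ind_nat_iff_ind_int Q u₀ m).2 hc')), zero_mul]
  rw [h1, sum_roots_sq_sub_eq_sum_levelForms D M (Froot Q u₀ h) (Froot_periodic hQ u₀ h)]
  -- Step 2: identify the summand with `Wf`
  refine Finset.sum_congr rfl fun R hR => ?_
  obtain ⟨-, hA, -, -⟩ := (mem_levelFormsUpTo (d := 1) one_pos).1 hR
  have hidx : ((index 1 R : ℕ) : ℤ) = R.a := by
    rw [index, Int.ediv_one]; exact Int.toNat_of_nonneg hA.le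
  rw [Froot, Wf]
  have hidxC : ((index 1 R : ℕ) : ℂ) = (R.a : ℂ) := by exact_mod_cast hidx
  simp only [hidx, hidxC]

/-- **Definite classes: the exponent bound** `|2Ap + Br| · r ≤ 2A · P(p, r)` (`Δ ≤ −1`:
`4AP = L² + |Δ| r² ≥ L² + r² ≥ 2|L| r`). [folklore] -/
theorem definite_arg_le {P : BinQF} (hΔ : P.disc < 0) (p : ℤ) (r : ℕ) :
    |((2 * P.a * p + P.b * r : ℤ) : ℝ)| * r ≤ (2 * P.a : ℝ) * (P.eval p r : ℝ) := by
  have hid := P.four_mul_a_mul_eval p r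
  set L : ℤ := 2 * P.a * p + P.b * r with hL
  have hΔ1 : P.disc ≤ -1 := by omega
  have key : 2 * |L| * (r : ℤ) ≤ 4 * P.a * P.eval p r := by
    rw [hid]
    have h1 : 2 * |L| * (r : ℤ) ≤ L ^ 2 + (r : ℤ) ^ 2 := by
      have := sq_nonneg (|L| - r); rw [← sq_abs L]; nlinarith [sq_abs L]
    have h2 : (r : ℤ) ^ 2 ≤ -P.disc * (r : ℤ) ^ 2 := by nlinarith [sq_nonneg (r : ℤ)]
    linarith
  have keyR : (2 : ℝ) * |(L : ℝ)| * r ≤ 4 * P.a * (P.eval p r : ℝ) := by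
    rw [← Int.cast_abs]; exact_mod_cast key
  linarith

/-- **Indefinite classes: the exponent bound** on the slices of the Pell sector:
`|2Ap + Br| · r ≤ 2η²A · P(p, r)` (the computation inside the tree's `indefinite_twist_le`).
[cite: Hooley1967, §6 (30)–(35)] -/
theorem indefinite_arg_le {P : BinQF} (hA : 0 < P.a) (hΔ : 0 < P.disc) (ε : Hooley1963.PosPell P.disc)
    {N r : ℕ} (hr : r ∈ Finset.Icc 1 (Hooley1963.iR P ε N)) {p : ℤ}
    (hp : p ∈ Finset.Ioo (Hooley1963.iLeft P ε r) (Hooley1963.iRight P ε N r)) :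
    |((2 * P.a * p + P.b * r : ℤ) : ℝ)| * r ≤ (2 * Hooley1963.eta P ε ^ 2 * P.a : ℝ) * (P.eval p r : ℝ) := by
  obtain ⟨hr1, hrR⟩ := Finset.mem_Icc.1 hr
  obtain ⟨hpa, hpb⟩ := Finset.mem_Ioo.1 hp
  obtain ⟨hmem, hPpos, -⟩ := (Hooley1963.indefinite_slice hA hΔ ε N r hr1 p).2 ⟨hrR, hpa, hpb⟩
  obtain ⟨h0, h1, h2⟩ := hmem
  have hs1 := Hooley1963.one_le_rt hΔ (P := P)
  have hr' : (1 : ℝ) ≤ r := by exact_mod_cast hr1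
  have hA' : (0 : ℝ) < P.a := by exact_mod_cast hA
  have hP' : (0 : ℝ) < (P.eval p r : ℝ) := by exact_mod_cast hPpos
  have hprod := Hooley1963.ellP_mul_ellM hΔ (P := P) (p, (r : ℤ))
  have hdiff := Hooley1963.ellP_sub_ellM (P := P) (p, (r : ℤ))
  simp only [Int.cast_natCast] at hprod hdiff
  set u : ℝ := 2 * P.a * p + P.b * r with hu
  have huP : u = Hooley1963.ellP P (p, (r : ℤ)) - Hooley1963.rt P * r := by
    simp only [Hooley1963.ellP, hu, Int.cast_natCast]; ring
  have hPl0 : 0 < Hooley1963.ellP P (p, (r : ℤ)) := by linarith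
  have hu0 : 0 ≤ u := by
    rw [huP]
    have : Hooley1963.rt P * r ≤ Hooley1963.ellP P (p, (r : ℤ)) - Hooley1963.ellM P (p, (r : ℤ)) := by
      rw [hdiff]; nlinarith
    nlinarith
  have hkey : u * r ≤ 2 * Hooley1963.eta P ε ^ 2 * P.a * (P.eval p r : ℝ) := by
    have hu_le : u ≤ Hooley1963.ellP P (p, (r : ℤ)) := by rw [huP]; nlinarith
    have hr_le : 2 * (r : ℝ) ≤ Hooley1963.ellP P (p, (r : ℤ)) := by nlinarith
    calc u * r ≤ Hooley1963.ellP P (p, (r : ℤ)) * (Hooley1963.ellP P (p, (r : ℤ)) / 2) := by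
          apply mul_le_mul hu_le (by linarith) (by positivity) hPl0.le
      _ ≤ Hooley1963.eta P ε ^ 2 * Hooley1963.ellM P (p, (r : ℤ)) * Hooley1963.ellP P (p, (r : ℤ)) / 2 := by
          nlinarith
      _ = 2 * Hooley1963.eta P ε ^ 2 * P.a * (P.eval p r : ℝ) := by
          rw [mul_assoc, mul_comm (Hooley1963.ellM P _), hprod]; ring
  have hucast : ((2 * P.a * p + P.b * r : ℤ) : ℝ) = u := by rw [hu]; push_cast; ring
  rw [hucast, abs_of_nonneg hu0]
  linarith

/-- **L7d — the explicit bound, class by class.**  For every class representative `R` of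
discriminant `4D` there is `C ≥ 0` with `‖∑_{Q' ∈ classFibre D R N} W(Q')‖ ≤ 1 + C Q^5 |h| Y(N)` for all
`Q ≥ 1`, `u₀`, `h ≠ 0`, `N ≥ 1` (`Y(N) = N^{13/16}(1 + log N)²`). [folklore] -/
theorem exists_classFibre_bound {D : ℤ} (hD : ¬ IsSquare D) (R : BinQF) :
    ∃ C : ℝ, 0 ≤ C ∧ ∀ (Q : ℕ), 0 < Q → ∀ (u₀ : ℕ) (h : ℤ), h ≠ 0 → ∀ N : ℕ, 1 ≤ N →
      ‖∑ Q' ∈ classFibre D R N, Wf Q u₀ h Q'‖ ≤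
        1 + C * (Q : ℝ) ^ 5 * |(h : ℝ)| * ((N : ℝ) ^ (13 / 16 : ℝ) * (1 + Real.log N) ^ 2) := by
  by_cases hne : ∃ (N₀ : ℕ) (Q₀ : BinQF), Q₀ ∈ classFibre D R N₀
  · obtain ⟨N₀, Q₀, h₀⟩ := hne
    have h4D : ¬ IsSquare (discrim 1 0 (-D)) := by
      rw [discrim_one_zero_neg]; exact not_isSquare_four_mul hD
    obtain ⟨⟨hL₀, hA₀, -, -⟩, -⟩ := (mem_fibre_iff (d := 1) (N := N₀) (R := R) one_pos).1 h₀
    have hdisc : Q₀.disc = 4 * D := by rw [hL₀.disc_eq, discrim_one_zero_neg]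
    have hΔ₀ : ¬ IsSquare Q₀.disc := by rw [hL₀.disc_eq]; exact h4D
    have hB₀ : Even Q₀.b := even_iff_two_dvd.2 (even_b_of_disc_eq hdisc)
    have hS : ∀ N, ∀ Q', Q' ∈ classFibre D R N ↔
        (∃ ξ : SL(2, ℤ), Q' = smul Q₀ ξ) ∧ IsTReduced Q' ∧ 0 < Q'.a ∧ Q'.a ≤ N :=
      fun N Q' => mem_classFibre_iff_of_mem hD h₀ N Q'
    have hD0 : D ≠ 0 := by rintro rfl; exact hD ⟨0, by ring⟩
    rcases lt_or_gt_of_ne hD0 with hDneg | hDpos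
    · -- definite
      have hΔneg : Q₀.disc < 0 := by rw [hdisc]; linarith
      obtain ⟨C, hC0, hC⟩ := exists_norm_class_sum_le (Hooley1963.definiteData Q₀ 0 hA₀ hΔneg) hA₀ hΔ₀ hB₀
        (κ := 2 * Q₀.a) (by positivity) (fun N _ r _ p _ => definite_arg_le hΔneg p r)
      exact ⟨C, hC0, fun Q hQ u₀ h hh N hN => hC Q hQ u₀ h hh N hN _ (hS N)⟩
    · -- indefinite
      have hΔpos : 0 < Q₀.disc := by rw [hdisc]; linarith
      obtain ⟨ε⟩ := Hooley1963.nonempty_posPell hΔpos hΔ₀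
      obtain ⟨C, hC0, hC⟩ := exists_norm_class_sum_le (Hooley1963.indefiniteData Q₀ 0 hA₀ hΔpos ε) hA₀ hΔ₀ hB₀
        (κ := 2 * Hooley1963.eta Q₀ ε ^ 2 * Q₀.a) (by positivity)
        (fun N _ r hr p hp => indefinite_arg_le hA₀ hΔpos ε hr hp)
      exact ⟨C, hC0, fun Q hQ u₀ h hh N hN => hC Q hQ u₀ h hh N hN _ (hS N)⟩
  · push Not at hne
    refine ⟨0, le_rfl, fun Q _ u₀ h _ N _ => ?_⟩
    have hzero : ∑ Q' ∈ classFibre D R N, Wf Q u₀ h Q' = 0 :=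
      Finset.sum_eq_zero fun Q' hQ' => absurd hQ' (hne N Q')
    rw [hzero, norm_zero]; positivity

/-- `(1 + log M)² ≤ 1089 · M^{1/16}` for `M ≥ 1` (`log M ≤ 32 M^{1/32}`). [folklore] -/
theorem one_add_log_sq_le {M : ℝ} (hM : 1 ≤ M) : (1 + Real.log M) ^ 2 ≤ 1089 * M ^ (1 / 16 : ℝ) := by
  have hM0 : 0 ≤ M := by linarith
  have h1 : Real.log M ≤ M ^ (1 / 32 : ℝ) / (1 / 32) := Real.log_le_rpow_div hM0 (by norm_num)
  have h2 : (1 : ℝ) ≤ M ^ (1 / 32 : ℝ) := Real.one_le_rpow hM (by norm_num)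
  have h3 : 1 + Real.log M ≤ 33 * M ^ (1 / 32 : ℝ) := by linarith
  have h4 : 0 ≤ 1 + Real.log M := by have := Real.log_nonneg hM; linarith
  calc (1 + Real.log M) ^ 2 ≤ (33 * M ^ (1 / 32 : ℝ)) ^ 2 := pow_le_pow_left₀ h4 h3 2
    _ = 1089 * M ^ (1 / 16 : ℝ) := by
        rw [mul_pow, ← Real.rpow_natCast (M ^ (1 / 32 : ℝ)), ← Real.rpow_mul hM0]; norm_num

/-- **The twisted Hooley bound for the dilates `Q²X² − D`** (`D` not a square): for all `Q ≥ 1`,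
`u`, `h ≠ 0`, `M ≥ 2`,
`‖∑_{m ≤ M, m ≡ u (Q), (m,Q)=1} S_{Q²X²−D}(h, m)‖ ≤ K(D) · Q^5 · |h|^5 · M^{7/8}` — a power saving
uniform (polynomially) in the class modulus `Q` and the frequency `h`.  Classes of discriminant `4D`
(`classReps`, a FIXED finite set — the regulator does not grow), `sum_filter_dilate_eq_sum_levelForms`,
and `exists_classFibre_bound` class by class.  Not in print as such; the `Q = 1` case is Hooley's
Theorem 1 (Acta Math. 110 (1963), with `M^{3/4} log² M`). [folklore] -/
theorem norm_sum_twistedDilates_le {D : ℤ} (hD : ¬ IsSquare D) :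
    ∃ K : ℝ, ∀ (Q u : ℕ) (h : ℤ) (M : ℕ), 0 < Q → h ≠ 0 → 2 ≤ M →
      ‖∑ m ∈ (Icc 1 M).filter (fun m : ℕ => m ≡ u [MOD Q] ∧ m.Coprime Q),
          polyRootWeylSum (C ((Q : ℤ) ^ 2) * X ^ 2 - C D) m h‖ ≤
        K * (Q : ℝ) ^ (5 : ℝ) * |(h : ℝ)| ^ (5 : ℝ) * (M : ℝ) ^ (1 - 1 / 8 : ℝ) := by
  have h4D : ¬ IsSquare (discrim 1 0 (-D)) := by
    rw [discrim_one_zero_neg]; exact not_isSquare_four_mul hD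
  choose C hC0 hC using fun R : BinQF => exists_classFibre_bound hD R
  set reps := classReps (discrim 1 0 (-D)) with hreps
  refine ⟨∑ R ∈ reps, (1 + 1089 * C R), ?_⟩
  intro Q u h M hQ hh hM
  have hM1 : 1 ≤ M := by omega
  have hM1R : (1 : ℝ) ≤ M := by exact_mod_cast hM1
  have hM0R : (0 : ℝ) ≤ M := by linarith
  have hQ1 : (1 : ℝ) ≤ Q := by exact_mod_cast hQ
  have hh1 : (1 : ℝ) ≤ |(h : ℝ)| := by rw [← Int.cast_abs]; exact_mod_cast Int.one_le_abs hh
  -- through forms and classes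
  rw [sum_filter_dilate_eq_sum_levelForms hQ u D h M,
    sum_levelFormsUpTo_eq_sum_classReps (a := 1) (b := 0) (c := -D) (d := 1) (N := M) one_pos h4D (Wf Q u h)]
  have hfib : ∀ R ∈ reps, ‖∑ Q' ∈ (levelFormsUpTo 1 0 (-D) 1 M).filter (fun Q' => rep Q' = R), Wf Q u h Q'‖ ≤
      1 + C R * (Q : ℝ) ^ 5 * |(h : ℝ)| * ((M : ℝ) ^ (13 / 16 : ℝ) * (1 + Real.log M) ^ 2) :=
    fun R _ => hC R Q hQ u h hh M hM1
  refine (norm_sum_le _ _).trans ((Finset.sum_le_sum hfib).trans ?_)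
  -- sizes: `Y(M) ≤ 1089 M^{7/8}`, `1 ≤ Q^5 |h|^5 M^{7/8}`
  set Z : ℝ := (Q : ℝ) ^ (5 : ℝ) * |(h : ℝ)| ^ (5 : ℝ) * (M : ℝ) ^ (1 - 1 / 8 : ℝ) with hZ
  have hQ5 : (1 : ℝ) ≤ (Q : ℝ) ^ (5 : ℝ) := Real.one_le_rpow hQ1 (by norm_num)
  have hh5 : |(h : ℝ)| ≤ |(h : ℝ)| ^ (5 : ℝ) := by
    conv_lhs => rw [← Real.rpow_one |(h : ℝ)|]
    exact Real.rpow_le_rpow_of_exponent_le hh1 (by norm_num)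
  have hh50 : (1 : ℝ) ≤ |(h : ℝ)| ^ (5 : ℝ) := Real.one_le_rpow hh1 (by norm_num)
  have hM78 : (1 : ℝ) ≤ (M : ℝ) ^ (1 - 1 / 8 : ℝ) := Real.one_le_rpow hM1R (by norm_num)
  have hZ1 : 1 ≤ Z := by
    rw [hZ]
    calc (1 : ℝ) = 1 * 1 * 1 := by ring
      _ ≤ (Q : ℝ) ^ (5 : ℝ) * |(h : ℝ)| ^ (5 : ℝ) * (M : ℝ) ^ (1 - 1 / 8 : ℝ) :=
          mul_le_mul (mul_le_mul hQ5 hh50 zero_le_one (by positivity)) hM78 zero_le_one (by positivity)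
  have hY : (Q : ℝ) ^ 5 * |(h : ℝ)| * ((M : ℝ) ^ (13 / 16 : ℝ) * (1 + Real.log M) ^ 2) ≤ 1089 * Z := by
    have h1 := one_add_log_sq_le hM1R
    have h2 : (M : ℝ) ^ (13 / 16 : ℝ) * (1 + Real.log M) ^ 2 ≤ 1089 * (M : ℝ) ^ (1 - 1 / 8 : ℝ) := by
      calc (M : ℝ) ^ (13 / 16 : ℝ) * (1 + Real.log M) ^ 2 ≤ (M : ℝ) ^ (13 / 16 : ℝ) * (1089 * (M : ℝ) ^ (1 / 16 : ℝ)) :=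
            mul_le_mul_of_nonneg_left h1 (by positivity)
        _ = 1089 * ((M : ℝ) ^ (13 / 16 : ℝ) * (M : ℝ) ^ (1 / 16 : ℝ)) := by ring
        _ = 1089 * (M : ℝ) ^ (1 - 1 / 8 : ℝ) := by
            rw [← Real.rpow_add' hM0R (by norm_num)]; norm_num
    have h3 : (Q : ℝ) ^ 5 = (Q : ℝ) ^ (5 : ℝ) := by rw [← Real.rpow_natCast]; norm_num
    rw [hZ, h3]
    calc (Q : ℝ) ^ (5 : ℝ) * |(h : ℝ)| * ((M : ℝ) ^ (13 / 16 : ℝ) * (1 + Real.log M) ^ 2)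
        ≤ (Q : ℝ) ^ (5 : ℝ) * |(h : ℝ)| ^ (5 : ℝ) * (1089 * (M : ℝ) ^ (1 - 1 / 8 : ℝ)) :=
          mul_le_mul (mul_le_mul_of_nonneg_left hh5 (by positivity)) h2 (by positivity) (by positivity)
      _ = 1089 * ((Q : ℝ) ^ (5 : ℝ) * |(h : ℝ)| ^ (5 : ℝ) * (M : ℝ) ^ (1 - 1 / 8 : ℝ)) := by ring
  have hterm : ∀ R ∈ reps, 1 + C R * (Q : ℝ) ^ 5 * |(h : ℝ)| * ((M : ℝ) ^ (13 / 16 : ℝ) * (1 + Real.log M) ^ 2) ≤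
      (1 + 1089 * C R) * Z := by
    intro R _
    have := mul_le_mul_of_nonneg_left hY (hC0 R)
    have e1 : C R * ((Q : ℝ) ^ 5 * |(h : ℝ)| * ((M : ℝ) ^ (13 / 16 : ℝ) * (1 + Real.log M) ^ 2)) =
        C R * (Q : ℝ) ^ 5 * |(h : ℝ)| * ((M : ℝ) ^ (13 / 16 : ℝ) * (1 + Real.log M) ^ 2) := by ring
    rw [e1] at this
    calc 1 + C R * (Q : ℝ) ^ 5 * |(h : ℝ)| * ((M : ℝ) ^ (13 / 16 : ℝ) * (1 + Real.log M) ^ 2)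
        ≤ Z + C R * (1089 * Z) := add_le_add hZ1 this
      _ = (1 + 1089 * C R) * Z := by ring
  calc ∑ R ∈ reps, (1 + C R * (Q : ℝ) ^ 5 * |(h : ℝ)| * ((M : ℝ) ^ (13 / 16 : ℝ) * (1 + Real.log M) ^ 2))
      ≤ ∑ R ∈ reps, (1 + 1089 * C R) * Z := Finset.sum_le_sum hterm
    _ = (∑ R ∈ reps, (1 + 1089 * C R)) * Z := by rw [Finset.sum_mul]
    _ = (∑ R ∈ reps, (1 + 1089 * C R)) * (Q : ℝ) ^ (5 : ℝ) * |(h : ℝ)| ^ (5 : ℝ) * (M : ℝ) ^ (1 - 1 / 8 : ℝ) := by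
        rw [hZ]; ring

end TwistedHooley

end Literature.NumberTheory.Sieve
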